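import Mathlib
import Literature.MathematicalPhysics.QuantumFieldTheory.MagnenRivasseauSeneor1993.MRS93AnisotropicSlicing
import Literature.MathematicalPhysics.QuantumFieldTheory.MagnenRivasseauSeneor1993.MRS93ConvergencePowerCounting
import Literature.MathematicalPhysics.QuantumFieldTheory.MagnenRivasseauSeneor1993.MRS93LargeFieldSmallFactor
import HarnessLib

/-!
# Magnen–Rivasseau–Sénéor, *Construction of YM₄ with an infrared cutoff* (CMP 155, 1993): the two displayed SLICED-PROPAGATOR
# DECAY estimates — §VII (VII.1) for the small-field propagator `C^j = κ^j(p)/p²` and §II.B (II.27) for the axial propagator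
# `C^j_axial = κ^j(p) C_axial(p)` — PROVED for MRS's own cutoff (II.14) and anisotropic slices (II.21a)–(II.21b), in the quantifier
# shapes of the tree's predicates `Convergence.IneqVII1Printed` and `LargeField.IneqII27Printed`

elementary real analysis of free sliced Euclidean propagators (smoothness of the printed cutoff, an anisotropic change of variables,
uniform derivative bounds by compactness in the anisotropy and the coupling, integration by parts in the Fourier integral through
Mathlib's `Real.pow_mul_norm_iteratedFDeriv_fourier_le`); nothing here is a claim about the Yang–Mills mass gap, about continuum YM₄
on `T⁴` (with or without infrared cutoff), or about the Clay problem — and nothing of MRS's expansion, of its convergence (Sect. VII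
is a SKETCH in print), of Lemma II.1 (whose sketch CONSUMES (II.27)) or of the main statement is asserted or upgraded

**Citation header (reproduction of PUBLISHED work).** J. Magnen, V. Rivasseau, R. Sénéor, *Construction of YM₄ with an infrared
cutoff*, Commun. Math. Phys. **155** (1993) 325–383 [MagnenRivasseauSeneor1993]: Sect. VII p.375 ((VII.1)); Sect. II.A pp.331–332
((II.13)–(II.15), the cutoff (II.14); (II.16), (II.19)); Sect. II.B pp.334–336 (the index set 𝐏, (II.21a)–(II.21b), (II.27) and the
sentence after it). Loci «p.NNN [PDF nn] tl.k» = journal page, PDF page (= journal page − 324), text-layer line of the held scan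
`paper:magnen1993-cmp155-mrs-ym4-infrared-cutoff`; the displays (VII.1) ∕ (II.27) as read on the page images of record
`run/shared/lean/pub/lit-balaban/inprint/lit-balaban-p14/renders-cmp155/p51_full_s6.png` ∕ `p11_full_s6.png` (quoted in
`…MRS93ConvergencePowerCounting` and `…MRS93LargeFieldSmallFactor`, whose predicates this file proves). Cell pub-balaban-gaps
(YM blitz, track G3), seat mrs-lit-2 (gen 17, file 44; v1 landed as p391498, EDITION v1.1 = §9g appended); companion record `run/shared/lean/pub/pub-balaban-gaps/g3/MRS-AS-PRINTED-estimates.md`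
§2 rows (VII.1), (II.27).

**What the paper prints (verbatim).**
* p.375 [PDF 51] tl.8–13: *«Let us consider the small field propagator in a slice of index j = {i, α}. From the point of view of
  power counting the homothetic gauge is similar to the Feynman gauge, hence to simplify notations let us pretend the small field
  propagator to be simply 1/p². The same propagator in the slice j would then be C^j = κ^j(p)/p². It satisfies the estimate
  C^j(x − y) ≤ K_q M^i M^α (1/(1 + |x₀ − y₀|M^α) · 1/(1 + |x⃗ − y⃗|M^i))^q (VII.1) for some large integer q.»*
* p.335 [PDF 11] tl.32–38 and p.336 [PDF 12] tl.2–5: *«Let us consider the propagator C_axial obtained by combining e^{−(1/2)⟨A,p₀²A⟩}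
  to … as in (II.18). … If we slice the propagator C_axial(p) according to the partition of unity given by the functions κ^j(p), we
  obtain pieces C^j_axial(p) ≡ κ^j(p)C_axial(p) which satisfy, for any fixed large integer q,
  C^j_axial(x − y) ≤ (K_q M^{2i}/λ)(1/(1 + |x₀ − y₀|M^α) · 1/(1 + |x⃗ − y⃗|M^i))^q, (II.27) where K_q is some constant depending on
  q. This bound is immediate if we use integration by parts and the bound M^{3i}M^α/(M^{2α} + λ²M^{2i}) ≤ … ≤ M^{2i}/λ if r = 1/2.»*
* p.334 [PDF 10] tl.44–47: *«For every value of i = 1, …, ρ₁ we introduce an index α with integer values between N_i and i+1, where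
  N_i is the integer part of i − |ln(λ_i^t)/ln M| (this rule seems obscure but is introduced because when |p| is of order M^i we want
  to decompose p₀ between λ_i M^i and M^{i+1}). The full set of ordered pairs (i, α) is called 𝐏»*; p.335 [PDF 11] tl.2–6:
  (II.21a)–(II.21b) (typed, with the misprinted superscript flagged, in `…MRS93AnisotropicSlicing`: `Ansatz.anisoSlice`); p.331
  [PDF 7] tl.2–9: (II.13)–(II.15) (`Ansatz.scaledCutoff`, `Ansatz.sliceCutoff`, `Ansatz.cutoffFn`, `Ansatz.lowIndex` of
  `…MRS93StartingAnsatz`); p.332: (II.16), (II.19) *«⟨A, p₀²A⟩ + Σ_i(λ_i^t)²⟨Ap²κ^i(p)A⟩ = ⟨A, C_axial⁻¹A⟩»* (`Ansatz.invCaxial`).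

**The objects (definitions with bodies, built on the tree's typed (II.14), (II.15), (II.21a/b)).**
* `SliceDecay.sliceMom P η M N i α p = κ^{i,α}(|p|, |p₀|)/|p|²` on Euclidean `ℝ⁴` (`EuclideanSpace ℝ (Fin 4)`, index `0` = time),
  with `κ^{i,α} = Ansatz.anisoSlice P η M (N i) i α` — the momentum-space `C^j` of (VII.1) for the bottom-index assignment `N`
  (`N_i`; a free parameter `ℕ → ℕ`); `SliceDecay.axialSliceMom P η M N λ i α p = κ^{i,α}(|p|, |p₀|)/(p₀² + λ²|p|²)` — the
  momentum-space `C^j_axial` of (II.27);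
* `SliceDecay.sliceKernel … z`, `SliceDecay.axialSliceKernel … z` `= Re ∫ e^{−2πi p·z} C^j(p) d⁴p` at `z = x − y = (z₀, z⃗) ∈ ℝ × ℝ³`
  (Mathlib's `𝓕`) — the position-space kernels `C^j(x − y)` ∕ `C^j_axial(x − y)`;
* `SliceDecay.kernelFamily`, `SliceDecay.axialKernelFamily` — the same kernels indexed by ALL pairs `(i, α)` as the predicates
  `Convergence.SliceBound` ∕ `LargeField.AxialSliceBound` demand: the kernel on the range of 𝐏 (`i ≥ 1`; `α ≤ i + 1`; for (II.27)
  also `N_i ≤ α` and the two defining inequalities of 𝐏, `λM^i ≤ M^{α+1}` and, on the bottom block, `M^α ≤ λM^i` — automatic for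
  MRS's `N_i`, §9f), `0` on the pairs that label no slice;
* auxiliary: `unitSlice` (`ψ(u) = κ(u) − κ(Mu)`: `κ^{i+1}(r) = ψ(r/M^{i+1})`, `sliceCutoff_succ_eq_unitSlice`), `timeProfile`
  (the time factor of `κ^{i,α}` as a dilate: `κ` for the bottom block `α = N_i` and for `α = 0`, `ψ` otherwise; `timeFactor_eq`),
  the coordinates `timeC`, `spat`, `emb`, the anisotropic scaling `scale a b : (p₀, p⃗) ↦ (a p₀, b p⃗)` (`det_scale = a b³`,
  self-adjoint `inner_scale_comm`), `scaleEquiv`, and the scaled families `fam` ∕ `famC` ((VII.1), parameter `ε`),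
  `famAxP` ∕ `famAxB` ((II.27), parameters `(ε, r, λ)`: pure time slices ∕ bottom block).

**What is PROVED (zero `sorry`, zero named facts; axioms `propext`, `Classical.choice`, `Quot.sound`).**
* §1 `Ansatz.contDiff_cutoffFn`: the cutoff `κ` of (II.14) is `C^∞` on `ℝ` for `η > 0` (it coincides with `(1 + τ)/2` on
  `r < 2 + η⁻¹` and with `τ(· − 1 − η⁻¹)/2` on `r > 2`: `cutoffFn_eq_of_lt`, `cutoffFn_eq_of_two_lt`); `Ansatz.contDiff_comp_norm_mul`,
  `Ansatz.contDiff_cutoffFn_comp_norm`: `p ↦ κ(c|p|)` is smooth on any real inner product space (`κ ≡ 1` near `0`).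
* §2 (generic devices, any normed parameter space) `norm_iteratedFDeriv_slice_le` (`‖Dᵐ_vΦ(θ,·)(v)‖ ≤ ‖DᵐΦ(θ,v)‖`),
  `exists_uniform_bound_iteratedFDeriv` (UNIFORM derivative bounds of a jointly smooth family over a compact parameter set, by
  continuity of `DᵐΦ` on a compact set), **`norm_fourier_le_of_iteratedFDeriv_le`** (integration by parts: a `Cⁿ` function
  supported in `B_R` with `‖Dᵐf‖ ≤ B`, `m ≤ n`, has `|𝓕f(w)| ≤ 4ⁿ(n+2)·B·vol(B_R)·(1 + |w|)^{−n}`, from Mathlib's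
  `Real.pow_mul_norm_iteratedFDeriv_fourier_le`), **`fourier_comp_symm`** (`𝓕(φ ∘ A⁻¹)(x) = |det A|·(𝓕φ)(Ax)` for a self-adjoint
  linear automorphism `A`, from `Measure.map_linearMap_addHaar_eq_smul_addHaar`); §9a **`exists_fourier_family_le`** (the three
  combined: ONE Fourier-decay constant for a smooth compactly supported family over a compact parameter set).
* §3–§5 the scaling structure of MRS's slices: `norm_sq_eq` (`|p|² = p₀² + |p⃗|²`), `det_scale`, `contDiff_scale_uncurry`;
  `unitSlice_eq_zero_of_le` ∕ `_of_ge` (support `M⁻¹ < u < 3 + η⁻¹`), `contDiff_unitSlice`, `timeProfile_props`; **`contDiff_fam`**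
  (the scaled family `g(|v₀|)ψ(|(εv₀, v⃗)|)|(εv₀, v⃗)|⁻²` is JOINTLY `C^∞` in `(ε, v)`: the inverse square is smooth off the zero
  set of `(εv₀, v⃗)`, near which the slice profile vanishes identically), `support_fam_subset` (support in `B_{2(3+η⁻¹)}` for
  EVERY `ε`), **`exists_fourier_famC_le`**.
* §6 **`sliceMom_scale`** — the exact anisotropic dilation `C^j(M^α v₀, M^i v⃗) = M^{−2i} Φ_g(M^{α−i}, v)` (`i ≥ 1`), and
  **`exists_sliceKernel_bound`** — **(VII.1)**: for `η > 0`, `M > 1`, every `q` there is `K_q ≥ 0` (depending on `q`, `M`, `η` and the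
  profile `τ` only) with `|C^{(i,α)}(z)| ≤ K_q M^i M^α (1/(1 + |z₀|M^α) · 1/(1 + |z⃗|M^i))^q` for ALL `i ≥ 1`, ALL `α ≤ i + 1`, ALL
  bottom-index assignments `N` and all `z` (the anisotropy `ε = M^{α−i} ∈ [0, M]` is the compact parameter; the prefactor
  `M^{−2i}·det = M^{−2i}·M^{α+3i} = M^iM^α` is the printed one).
* §7 **`ineqVII1Printed_kernelFamily`**: `Convergence.IneqVII1Printed (kernelFamily P η M N) M` — the tree's AS-PRINTED predicate
  (file `MRS93ConvergencePowerCounting`, typed earlier by this seat and left unproved: *«a standard integration-by-parts estimate,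
  not proved here»*) PROVED for the kernel the sentence defines; `ineqVII1Printed_exists_kernelFamily` (the literal «for some large
  integer q»); `sliceMom_eq_zero_of_le` (for `M ≥ 3 + η⁻¹` and `N_i ≤ i + 1` the slices with `α ≥ i + 2` vanish identically) and
  `ineqVII1Printed_sliceKernel` (so the family of ALL `C^{(i,α)}`, `i ≥ 1`, unrestricted in `α`, obeys (VII.1)).
* §8 `sliceKernelPhys` ∕ `kernelFamilyPhys` ∕ **`ineqVII1Printed_kernelFamilyPhys`**: the same in the phase convention
  `∫ e^{ip·(x−y)} C^j(p) d⁴p` of [R] (III.3.3) («C^i = ∫e^{ip(x−y)} η^i(p²)∕p² d⁴p»), `= (𝓕C^j)(−(x−y)/2π)`, with `K_q ↦ (2π)^{2q}K_q`.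
* §9 **(II.27)**: `contDiff_famAxP` ∕ `contDiff_famAxB` (the two scaled axial families `g(|v₀|)ψ(|(εv₀,v⃗)|)/((1+λ²)v₀² + r²|v⃗|²)`
  are jointly `C^∞` in `((ε, r, λ), v)` — pure time slices for all `r`, the bottom block for `r² = 1 + ρ² ≥ 1`), `support_famAx_subset`,
  `abs_re_fourier_le_of_scale` + `decay_prod_of_scale` (the generic Fourier assembly), **`axialSliceMom_scale`**
  (`C^j_axial(M^αv₀, M^iv⃗) = M^{−2α}·g(|v₀|)ψ(|(εv₀,v⃗)|)/((1+λ²)v₀² + r²|v⃗|²)`, `r = λM^{i−α}`), **`exists_axialSliceKernel_bound`**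
  — for `η > 0`, `M > 1`, every `q` ONE `K_q ≥ 0` such that for every `0 < λ ≤ 1`, every `N`, every `i ≥ 1` and `N_i ≤ α ≤ i + 1` with
  `λM^i ≤ M^{α+1}` and (`α = N_i ⟹ M^α ≤ λM^i`): `|C^j_axial(z)| ≤ K_q (M^{2i}/λ)(1/(1 + |z₀|M^α) · 1/(1 + |z⃗|M^i))^q` (compact
  parameters `(ε, r, λ) ∈ [0,M]×[0,M]×[0,1]`; prefactor `M^{−2α}·M^{α+3i} = (M^{2i}/λ)·r ≤ M·M^{2i}/λ` — the sentence after (II.27)),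
  **`ineqII27Printed_axialKernelFamily`**: `LargeField.IneqII27Printed (axialKernelFamily P η M N λ) M λ` — the tree's AS-PRINTED
  predicate (file `MRS93LargeFieldSmallFactor`: *«NOT proved here (it is an integration-by-parts estimate …)»*) PROVED for the sliced
  axial propagator; §9f **`lowIndex_window`** — MRS's «obscure rule» `N_i = ⌊i − |ln λ/ln M|⌋` (`Ansatz.lowIndex`) gives EXACTLY the two
  inequalities (`M^{N_i} ≤ λM^i ≤ M^{α+1}` for `α ≥ N_i`), and **`ineqII27Printed_of_lowIndex`**: with MRS's own `N_i ≥ 0`, (II.27)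
  holds for the family «`C^j_axial` on 𝐏, `0` off 𝐏».
* §9g (EDITION v1.1, append-only) `invCaxial_const_eq` + **`axialSliceMom_eq_div_invCaxial`**: for `M ≥ 3 + η⁻¹` and slices
  strictly below the fake cutoff (`i + 1 ≤ ρ₁`) the momentum-space axial slice of §9e IS `κ^j(p)/C_axial⁻¹(p)` with `C_axial⁻¹` the
  tree's typed (II.19) symbol `Ansatz.invCaxial P η M (fun _ => λ) ρ₁` (constant tentative couplings) for EVERY `p` — so of the model
  reading (vi) below only «one coupling on all slices» and «continuum momenta» remain; `axialSliceKernel_zero_le`: the diagonal value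
  `|C^j_axial(0)| ≤ K (M^iλ^{−1/2})²` («a typical size M^iλ^{−1/2}», p.336 tl.8–10); §9h `integrable_decay_pow_four` +
  `axialSliceKernel_dominated_integrable`: *«it might be sufficient to take q in (II.27) equal to 4, so that the propagator is summable»*
  (p.336 tl.14–16) — the `q = 4` decay factor is integrable over `ℝ × ℝ³` (Mathlib `integrable_one_add_norm`, dimensions `1, 3 < 4`).

**Readings (declared).** (i) FOURIER CONVENTION: kernels are typed with Mathlib's `𝓕f(z) = ∫ e^{−2πi⟨p,z⟩} f(p) dp` (§8 gives the
phase convention `e^{ip·z}` for (VII.1); the same rescaling applies to (II.27), not repeated); an overall `(2π)^{−4}` only rescales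
`K_q`. (ii) `κ^i(p)` is evaluated at the Euclidean length `|p|` of the 4-momentum and `κ^α`/`κ_{N_i}` at `|p₀|` (reading (iv) of
`…MRS93AnisotropicSlicing`); `p² = |p|²`. (iii) `C^j(x − y)` is the real part of the Fourier integral (the integrands are real and
even). (iv) Natural scale indices, `M` real (`> 1`; an integer in print, p.335 tl.18), `N : ℕ → ℕ` a free parameter; for (II.27)
§9f specialises to the print's `N_i = ⌊i − |ln λ/ln M|⌋` when it is `≥ 0` (for `N_i < 0` the print is silent, as recorded in
`…MRS93AnisotropicSlicing`; so is this file). (v) «for any fixed large integer q» ∕ «for some large integer q» = `∀ q ∃ K_q`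
(the trees' readings; the literal forms are derived). (vi) MODEL READING for (II.27): `C_axial(p)⁻¹ = p₀² + λ²p²`, i.e. (II.19)
with ONE coupling `λ` on the slices (the print's (II.16) carries `λ_i^t`, slowly varying; (II.27) itself prints a single `λ`) and the
fake cutoff `κ_{ρ₁} ≡ 1` on the slice; continuum `ℝ⁴` momenta (the paper's torus momenta `ℤ⁴ ∖ {0}` become continuous: the kernels
are the infinite-volume ones — the standard reading of a position-space decay estimate, declared). (vii) The constants are
existential (suprema of continuous functions on compact sets; the print: «some constant depending on q»), uniform in the slice
indices, in `N` and (for (II.27)) in `λ ∈ (0, 1]`.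

**What is NOT claimed or typed.** The small-field propagator of the homothetic gauge itself (MRS *«pretend … to be simply 1/p²»*) and
its background-field dependence; the vertical ∕ horizontal resummations of Sect. VII that CONSUME (VII.1) (power counting typed as
arithmetic in `…MRS93ConvergencePowerCounting`); Lemma II.1 itself (its sketch consumes (II.27) together with (II.28) and Sect. VI —
`…MRS93LargeFieldSmallFactor`); the Gaussian-measure statements about `dμ_axial` (`…MRS93AxialGaussianMeasure`); (II.27) for
negative bottom indices or slice-dependent couplings `λ_i^t`; derivative bounds on the kernels; anything about Bałaban's programme.
Sects. II.B ∕ VII stay SKETCH in print; the grade of record (YM-INPRINT D1) does not move.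

**Mathlib / tree search.** `lean search 'contDiff.*cutoffFn'`: only unrelated cutoffs (`FluidPDE`, `RiemannHypothesis`), none for
`Ansatz.cutoffFn`; `lean search 'IneqVII1Printed|SliceBound|IneqII27Printed|AxialSliceBound'`: the predicates and their `_anti` ∕
`_exists` lemmas only. Mathlib (this pin) has the Fourier-derivative calculus (`fourier_iteratedFDeriv`,
`pow_mul_norm_iteratedFDeriv_fourier_le`), the linear change of variables for Haar measure (`map_linearMap_addHaar_eq_smul_addHaar`),
`contDiff_piLp_apply`, `contDiffAt_norm`; the tree's `Literature/Probability/LatticeModels/ScaledKernelCubeDecay.lean` has the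
ISOTROPIC dilation `fourier_comp_inv_smul` and Schwartz-seminorm decay (`exists_profile_bound_re_fourier`),
`…/ParametricSlicePropagator.lean` the parametric slices of [R] — the anisotropic, uniform-in-`(i, α, λ)` statements needed here are
new. Nothing re-declared.

## References

* [MagnenRivasseauSeneor1993] J. Magnen, V. Rivasseau, R. Sénéor, *Construction of YM₄ with an infrared cutoff*, Commun. Math.
  Phys. 155 (1993) 325–383: (VII.1) p.375 tl.8–13; (II.27) p.335 tl.32–38, p.336 tl.2–5; (II.13)–(II.15) p.331; (II.16), (II.19)
  p.332; (II.21a)–(II.21b) p.335; p.334 tl.44–47.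
* [Rivasseau1991] V. Rivasseau, *From Perturbative to Constructive Renormalization*, Princeton University Press 1991, §III.3
  (III.3.3) PDF p.212 (the phase convention of §8); §II.1 (II.1.23) PDF p.62 (scaled power decay of sliced propagators).
-/

noncomputable section

open scoped ContDiff FourierTransform InnerProductSpace
open MeasureTheory Set

namespace Literature.MathematicalPhysics.QuantumFieldTheory.MagnenRivasseauSeneor1993

/-! ## §1 Smoothness of the momentum cutoff (II.14) -/

namespace Ansatz

variable (P : CutoffProfile) {η : ℝ}

/-- On `r < 2 + η⁻¹` the cutoff (II.14) is the smooth function `(1 + τ(r))/2`. [cite: MagnenRivasseauSeneor1993, (II.14) p.331] -/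
theorem cutoffFn_eq_of_lt {r : ℝ} (hr : r < 2 + η⁻¹) :
    cutoffFn P η r = (1 + P.τ r) / 2 := by
  unfold cutoffFn
  by_cases h1 : r ≤ 1
  · rw [if_pos h1, P.eq_one_of_le_one r h1]; norm_num
  · rw [if_neg h1]
    by_cases h2 : r ≤ 2
    · rw [if_pos h2]
    · rw [if_neg h2, if_pos hr.le, P.eq_zero_of_two_le r (le_of_lt (lt_of_not_ge h2))]; norm_num

/-- On `2 < r` the cutoff (II.14) is the smooth function `τ(r − 1 − η⁻¹)/2`. [cite: MagnenRivasseauSeneor1993, (II.14) p.331] -/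
theorem cutoffFn_eq_of_two_lt {r : ℝ} (hr : 2 < r) :
    cutoffFn P η r = (1 / 2) * P.τ (r - 1 - η⁻¹) := by
  unfold cutoffFn
  have h1 : ¬ r ≤ 1 := by linarith
  have h2 : ¬ r ≤ 2 := by linarith
  rw [if_neg h1, if_neg h2]
  by_cases h3 : r ≤ 2 + η⁻¹
  · rw [if_pos h3, P.eq_one_of_le_one _ (by linarith)]; norm_num
  · rw [if_neg h3]

/-- The momentum cutoff `κ` of (II.14) is `C^∞` as a function of `r = |p|` (the pieces `(1 + τ)/2` and `τ(· − 1 − η⁻¹)/2`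
agree with it on the overlapping open sets `r < 2 + η⁻¹`, `r > 2`; «τ is a fixed function which is between 0 and 1, is 1 near
0 and decreases at infinity», p.330 tl.31–32, typed `C^∞` in `Ansatz.CutoffProfile`).
[cite: MagnenRivasseauSeneor1993, (II.14) p.331; §II.A p.330 tl.31–32] -/
theorem contDiff_cutoffFn (hη : 0 < η) (n : ℕ∞) : ContDiff ℝ n (cutoffFn P η) := by
  have hinv : 0 < η⁻¹ := inv_pos.mpr hη
  have hf1 : ContDiff ℝ n (fun r : ℝ => (1 + P.τ r) / 2) := (contDiff_const.add (P.contDiff n)).div_const _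
  have hf2 : ContDiff ℝ n (fun r : ℝ => (1 / 2) * P.τ (r - 1 - η⁻¹)) :=
    contDiff_const.mul ((P.contDiff n).comp ((contDiff_id.sub contDiff_const).sub contDiff_const))
  rw [contDiff_iff_contDiffAt]
  intro r
  rcases lt_or_ge r (2 + η⁻¹) with h | h
  · refine (hf1.contDiffAt).congr_of_eventuallyEq ?_
    filter_upwards [Iio_mem_nhds h] with s hs using cutoffFn_eq_of_lt P hs
  · have h2 : 2 < r := by linarith
    refine (hf2.contDiffAt).congr_of_eventuallyEq ?_
    filter_upwards [Ioi_mem_nhds h2] with s hs using cutoffFn_eq_of_two_lt P hs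

variable {V : Type*} [NormedAddCommGroup V] [InnerProductSpace ℝ V]

/-- A smooth radial profile which is constant near `r = 0` gives a smooth function `p ↦ g(c‖p‖)` (`c > 0`) on any real inner
product space (the device behind «κ_ρ(p) = κ(pM^{−ρ})» as a smooth function of the momentum). [cite: MagnenRivasseauSeneor1993, (II.13)–(II.14) p.331] -/
theorem contDiff_comp_norm_mul {g : ℝ → ℝ} {n : ℕ∞} (hg : ContDiff ℝ n g) {δ : ℝ} (hδ : 0 < δ)
    (h0 : ∀ r, r < δ → g r = g 0) {c : ℝ} (hc : 0 < c) :
    ContDiff ℝ n (fun p : V => g (c * ‖p‖)) := by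
  rw [contDiff_iff_contDiffAt]
  intro p
  by_cases hp : p = 0
  · subst hp
    have hev : ∀ᶠ q in nhds (0 : V), g (c * ‖q‖) = g 0 := by
      have : Metric.ball (0 : V) (δ / c) ∈ nhds (0 : V) := Metric.ball_mem_nhds _ (div_pos hδ hc)
      filter_upwards [this] with q hq
      rw [Metric.mem_ball, dist_zero_right] at hq
      apply h0
      calc c * ‖q‖ < c * (δ / c) := mul_lt_mul_of_pos_left hq hc
        _ = δ := mul_div_cancel₀ δ hc.ne'
    exact (contDiffAt_const (c := g 0)).congr_of_eventuallyEq hev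
  · exact hg.contDiffAt.comp p ((contDiffAt_const.mul (contDiffAt_norm ℝ hp)))

/-- `p ↦ κ(c‖p‖)` is smooth for `c > 0` («κ_ρ(p) = κ(pM^{−ρ})»). [cite: MagnenRivasseauSeneor1993, (II.13)–(II.14) p.331] -/
theorem contDiff_cutoffFn_comp_norm (hη : 0 < η) (n : ℕ∞) {c : ℝ} (hc : 0 < c) :
    ContDiff ℝ n (fun p : V => cutoffFn P η (c * ‖p‖)) :=
  contDiff_comp_norm_mul (contDiff_cutoffFn P hη n) one_pos
    (fun r hr => by rw [cutoffFn_of_le_one P η hr.le, cutoffFn_of_le_one P η zero_le_one]) hc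

end Ansatz

namespace SliceDecay

/-! ## §2 Generic analysis: uniform derivative bounds of a smooth family, Fourier decay by integration by parts, linear change of variables -/

variable {V : Type*} [NormedAddCommGroup V] [NormedSpace ℝ V]
variable {F : Type*} [NormedAddCommGroup F] [NormedSpace ℝ F]
variable {Pm : Type*} [NormedAddCommGroup Pm] [NormedSpace ℝ Pm]

/-- Restricting a jointly smooth `Φ(ε, v)` to a slice `ε = const` does not increase the operator norm of the
`v`-derivatives: `‖Dᵐ_v Φ(ε, ·)(v)‖ ≤ ‖DᵐΦ(ε, v)‖` (device for the uniformity of `K_q` in the slice indices).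
[cite: MagnenRivasseauSeneor1993, §VII (VII.1) p.375 («K_q» independent of j); folklore] -/
theorem norm_iteratedFDeriv_slice_le {Φ : Pm × V → F} {N : ℕ∞} (hΦ : ContDiff ℝ N Φ) {m : ℕ}
    (hm : (m : ℕ∞) ≤ N) (ε : Pm) (v : V) :
    ‖iteratedFDeriv ℝ m (fun v => Φ (ε, v)) v‖ ≤ ‖iteratedFDeriv ℝ m Φ (ε, v)‖ := by
  have hfun : (fun v => Φ (ε, v)) =
      (fun u : Pm × V => Φ (((ε, (0 : V)) : Pm × V) + u)) ∘ (ContinuousLinearMap.inr ℝ Pm V) := by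
    funext v; simp
  have hg : ContDiff ℝ N (fun u : Pm × V => Φ (((ε, (0 : V)) : Pm × V) + u)) :=
    hΦ.comp (contDiff_const.add contDiff_id)
  rw [hfun, ContinuousLinearMap.iteratedFDeriv_comp_right _ hg _ (by exact_mod_cast hm)]
  refine (ContinuousMultilinearMap.norm_compContinuousLinearMap_le _ _).trans ?_
  rw [iteratedFDeriv_comp_add_left]
  have h1 : ∏ _i : Fin m, ‖ContinuousLinearMap.inr ℝ Pm V‖ ≤ 1 := by
    refine Finset.prod_le_one (fun _ _ => norm_nonneg _) (fun _ _ => ?_)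
    refine ContinuousLinearMap.opNorm_le_bound _ zero_le_one (fun x => ?_)
    simp [Prod.norm_def]
  have h2 : ((ε, (0 : V)) : Pm × V) + (ContinuousLinearMap.inr ℝ Pm V) v = (ε, v) := by simp
  rw [h2]
  calc ‖iteratedFDeriv ℝ m Φ (ε, v)‖ * ∏ _i : Fin m, ‖ContinuousLinearMap.inr ℝ Pm V‖
      ≤ ‖iteratedFDeriv ℝ m Φ (ε, v)‖ * 1 := mul_le_mul_of_nonneg_left h1 (norm_nonneg _)
    _ = ‖iteratedFDeriv ℝ m Φ (ε, v)‖ := mul_one _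

/-- UNIFORM derivative bounds for a smooth family with a compact parameter set: if `Φ : Pm × V → F` is `C^N`,
`S ⊆ Pm` is compact (any normed parameter space `Pm`) and for `ε ∈ S` the function `Φ(ε, ·)` is supported in the closed ball of radius `R`
(`V` finite-dimensional), then for `m ≤ N` one constant bounds `‖Dᵐ_vΦ(ε, ·)(v)‖` for all `ε ∈ S` and
all `v` (continuity of `DᵐΦ` on the compact `S × B_R`). [cite: MagnenRivasseauSeneor1993, §VII (VII.1) p.375 («K_q» independent of j); folklore] -/
theorem exists_uniform_bound_iteratedFDeriv [ProperSpace V] {Φ : Pm × V → F} {N : ℕ∞} (hΦ : ContDiff ℝ N Φ)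
    {S : Set Pm} (hS : IsCompact S) {R : ℝ}
    (hsupp : ∀ ε ∈ S, Function.support (fun v => Φ (ε, v)) ⊆ Metric.closedBall (0 : V) R)
    {m : ℕ} (hm : (m : ℕ∞) ≤ N) :
    ∃ B : ℝ, 0 ≤ B ∧ ∀ ε ∈ S, ∀ v : V, ‖iteratedFDeriv ℝ m (fun v => Φ (ε, v)) v‖ ≤ B := by
  have hK : IsCompact (S ×ˢ Metric.closedBall (0 : V) R) := hS.prod (isCompact_closedBall _ _)
  have hcont : Continuous (fun q : Pm × V => iteratedFDeriv ℝ m Φ q) := hΦ.continuous_iteratedFDeriv (by exact_mod_cast hm)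
  obtain ⟨B, hB⟩ := hK.exists_bound_of_continuousOn hcont.continuousOn
  refine ⟨max B 0, le_max_right _ _, fun ε hε v => ?_⟩
  by_cases hv : v ∈ Metric.closedBall (0 : V) R
  · exact ((norm_iteratedFDeriv_slice_le hΦ hm ε v).trans (hB (ε, v) ⟨hε, hv⟩)).trans (le_max_left _ _)
  · have hts : tsupport (fun v => Φ (ε, v)) ⊆ Metric.closedBall (0 : V) R :=
      closure_minimal (hsupp ε hε) Metric.isClosed_closedBall
    have h0 : iteratedFDeriv ℝ m (fun v => Φ (ε, v)) v = 0 := by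
      by_contra hne
      exact hv (hts (support_iteratedFDeriv_subset m (Function.mem_support.mpr hne)))
    rw [h0, norm_zero]; exact le_max_right _ _

section Fourier

variable {W : Type*} [NormedAddCommGroup W] [InnerProductSpace ℝ W] [FiniteDimensional ℝ W]
  [MeasurableSpace W] [BorelSpace W]

/-- `(1 + a)^n ≤ 2^n (1 + a^n)` for `a ≥ 0`. [folklore] -/
private theorem one_add_pow_le_two_pow_mul {a : ℝ} (ha : 0 ≤ a) (n : ℕ) : (1 + a) ^ n ≤ 2 ^ n * (1 + a ^ n) := by
  rcases le_total a 1 with h | h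
  · calc (1 + a) ^ n ≤ 2 ^ n := pow_le_pow_left₀ (by positivity) (by linarith) n
      _ ≤ 2 ^ n * (1 + a ^ n) := le_mul_of_one_le_right (by positivity) (by
          have := pow_nonneg ha n; linarith)
  · calc (1 + a) ^ n ≤ (2 * a) ^ n := pow_le_pow_left₀ (by positivity) (by linarith) n
      _ = 2 ^ n * a ^ n := mul_pow _ _ _
      _ ≤ 2 ^ n * (1 + a ^ n) := mul_le_mul_of_nonneg_left (by linarith) (by positivity)

/-- **The integration-by-parts estimate** («This bound is immediate if we use integration by parts», CMP 155 p.336;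
here through Mathlib's `Real.pow_mul_norm_iteratedFDeriv_fourier_le`): a `Cⁿ` function supported in the ball of
radius `R` whose derivatives of order `≤ n` are bounded by `B` has a Fourier transform bounded by
`4ⁿ(n + 2)·B·vol(B_R)·(1 + ‖w‖)^{−n}`. [cite: MagnenRivasseauSeneor1993, §II.B p.336 tl.2–3; §VII (VII.1) p.375] -/
theorem norm_fourier_le_of_iteratedFDeriv_le {f : W → ℂ} {n : ℕ} (hf : ContDiff ℝ n f) {R B : ℝ}
    (hB : 0 ≤ B) (hsupp : Function.support f ⊆ Metric.closedBall (0 : W) R)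
    (hbound : ∀ m, m ≤ n → ∀ v, ‖iteratedFDeriv ℝ m f v‖ ≤ B) (w : W) :
    ‖𝓕 f w‖ ≤ 4 ^ n * (n + 2) * B * (volume (Metric.closedBall (0 : W) R)).toReal * ((1 + ‖w‖) ^ n)⁻¹ := by
  set VR : ℝ := (volume (Metric.closedBall (0 : W) R)).toReal with hVR
  have hVR0 : 0 ≤ VR := ENNReal.toReal_nonneg
  have hts : tsupport f ⊆ Metric.closedBall (0 : W) R := closure_minimal hsupp Metric.isClosed_closedBall
  have hcs : HasCompactSupport f :=
    IsCompact.of_isClosed_subset (isCompact_closedBall _ _) (isClosed_tsupport f) hts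
  -- integrability hypothesis of the Mathlib lemma (K = 0)
  have h'f : ∀ (k m : ℕ), (k : ℕ∞) ≤ 0 → (m : ℕ∞) ≤ n →
      Integrable (fun v ↦ ‖v‖ ^ k * ‖iteratedFDeriv ℝ m f v‖) := by
    intro k m hk hm
    have hmc : Continuous (iteratedFDeriv ℝ m f) := hf.continuous_iteratedFDeriv (by exact_mod_cast hm)
    refine Continuous.integrable_of_hasCompactSupport ((continuous_norm.pow k).mul hmc.norm) ?_
    exact ((hcs.iteratedFDeriv m).norm).mul_left
  -- each integral in the Mathlib bound is ≤ B · vol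
  have hint : ∀ p ∈ Finset.range (0 + 1) ×ˢ Finset.range (n + 1),
      ∫ v, ‖v‖ ^ p.1 * ‖iteratedFDeriv ℝ p.2 f v‖ ≤ B * VR := by
    intro p hp
    simp only [Finset.mem_product, Finset.mem_range, zero_add, Nat.lt_one_iff] at hp
    obtain ⟨hp1, hp2⟩ := hp
    have hle : ∀ v, ‖v‖ ^ p.1 * ‖iteratedFDeriv ℝ p.2 f v‖ ≤
        (Metric.closedBall (0 : W) R).indicator (fun _ => B) v := by
      intro v
      rw [hp1, pow_zero, one_mul]
      by_cases hv : v ∈ Metric.closedBall (0 : W) R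
      · rw [indicator_of_mem hv]; exact hbound p.2 (Nat.lt_succ_iff.mp hp2) v
      · rw [indicator_of_notMem hv]
        have h0 : iteratedFDeriv ℝ p.2 f v = 0 := by
          by_contra hne
          exact hv (hts (support_iteratedFDeriv_subset p.2 (Function.mem_support.mpr hne)))
        rw [h0, norm_zero]
    calc ∫ v, ‖v‖ ^ p.1 * ‖iteratedFDeriv ℝ p.2 f v‖
        ≤ ∫ v, (Metric.closedBall (0 : W) R).indicator (fun _ => B) v := by
          refine integral_mono (h'f p.1 p.2 (by rw [hp1]; exact le_rfl) (by exact_mod_cast Nat.lt_succ_iff.mp hp2)) ?_ hle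
          exact (integrableOn_const (hs := measure_closedBall_lt_top.ne)).integrable_indicator measurableSet_closedBall
      _ = B * VR := by
          rw [integral_indicator_const _ measurableSet_closedBall, hVR, smul_eq_mul, mul_comm]
          rfl
  -- the Mathlib estimate at exponents 0 and n
  have key : ∀ j, j ≤ n → ‖w‖ ^ j * ‖𝓕 f w‖ ≤ 2 ^ j * ((j + 1) * (B * VR)) := by
    intro j hj
    have h := Real.pow_mul_norm_iteratedFDeriv_fourier_le (K := 0) (N := n) (hf := hf) h'f (k := 0) (n := j)
      le_rfl (by exact_mod_cast hj) w
    rw [norm_iteratedFDeriv_zero] at h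
    refine h.trans ?_
    have hsum : ∑ p ∈ Finset.range (0 + 1) ×ˢ Finset.range (j + 1), ∫ v, ‖v‖ ^ p.1 * ‖iteratedFDeriv ℝ p.2 f v‖
        ≤ (j + 1) * (B * VR) := by
      have hsub : Finset.range (0 + 1) ×ˢ Finset.range (j + 1) ⊆ Finset.range (0 + 1) ×ˢ Finset.range (n + 1) :=
        Finset.product_subset_product le_rfl (Finset.range_mono (by omega))
      calc ∑ p ∈ Finset.range (0 + 1) ×ˢ Finset.range (j + 1), ∫ v, ‖v‖ ^ p.1 * ‖iteratedFDeriv ℝ p.2 f v‖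
          ≤ ∑ _p ∈ Finset.range (0 + 1) ×ˢ Finset.range (j + 1), B * VR :=
            Finset.sum_le_sum (fun p hp => hint p (hsub hp))
        _ = (j + 1) * (B * VR) := by simp
    calc (2 * Real.pi) ^ 0 * (2 * ((0 : ℕ) : ℝ) + 2) ^ j *
          ∑ p ∈ Finset.range (0 + 1) ×ˢ Finset.range (j + 1), ∫ v, ‖v‖ ^ p.1 * ‖iteratedFDeriv ℝ p.2 f v‖
        ≤ (2 * Real.pi) ^ 0 * (2 * ((0 : ℕ) : ℝ) + 2) ^ j * ((j + 1) * (B * VR)) :=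
          mul_le_mul_of_nonneg_left hsum (by positivity)
      _ = 2 ^ j * ((j + 1) * (B * VR)) := by norm_num
  have k0 := key 0 (Nat.zero_le n)
  have kn := key n le_rfl
  simp only [pow_zero, one_mul, CharP.cast_eq_zero, zero_add] at k0
  have hpos : 0 < (1 + ‖w‖) ^ n := by positivity
  rw [← div_eq_mul_inv, le_div_iff₀ hpos]
  have h1 := one_add_pow_le_two_pow_mul (norm_nonneg w) n
  have hF0 : 0 ≤ ‖𝓕 f w‖ := norm_nonneg _
  calc ‖𝓕 f w‖ * (1 + ‖w‖) ^ n ≤ ‖𝓕 f w‖ * (2 ^ n * (1 + ‖w‖ ^ n)) := mul_le_mul_of_nonneg_left h1 hF0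
    _ = 2 ^ n * (‖𝓕 f w‖ + ‖w‖ ^ n * ‖𝓕 f w‖) := by ring
    _ ≤ 2 ^ n * (B * VR + 2 ^ n * ((n + 1) * (B * VR))) := by gcongr
    _ ≤ 4 ^ n * (n + 2) * B * VR := by
        have h4 : (4 : ℝ) ^ n = 2 ^ n * 2 ^ n := by rw [← mul_pow]; norm_num
        rw [h4]
        have h2n : (1 : ℝ) ≤ 2 ^ n := one_le_pow₀ (by norm_num)
        have hX : 0 ≤ B * VR := mul_nonneg hB hVR0
        have hP : (0 : ℝ) ≤ 2 ^ n := by positivity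
        have hPX : 2 ^ n * (B * VR) ≤ 2 ^ n * 2 ^ n * (B * VR) := by
          rw [mul_assoc]
          exact mul_le_mul_of_nonneg_left (le_mul_of_one_le_left hX h2n) hP
        nlinarith [hPX, hX, hP]

end Fourier


section Fourier2

variable {W : Type*} [NormedAddCommGroup W] [InnerProductSpace ℝ W] [FiniteDimensional ℝ W]
  [MeasurableSpace W] [BorelSpace W]

/-- Linear change of variables in the Fourier integral: for a self-adjoint linear automorphism `A`,
`𝓕(φ ∘ A⁻¹)(x) = |det A| · (𝓕φ)(A x)` (the anisotropic rescaling `p₀ = M^α v₀`, `p⃗ = M^i v⃗` behind the prefactor `M^iM^α` of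
(VII.1)). [cite: MagnenRivasseauSeneor1993, §VII (VII.1) p.375; folklore] -/
theorem fourier_comp_symm (A : W ≃L[ℝ] W) (hA : ∀ u v : W, ⟪A u, v⟫_ℝ = ⟪u, A v⟫_ℝ) (φ : W → ℂ) (x : W) :
    𝓕 (fun p => φ (A.symm p)) x =
      (((|LinearMap.det (A.toLinearEquiv : W →ₗ[ℝ] W)| : ℝ)) : ℂ) * 𝓕 φ (A x) := by
  set d : ℝ := LinearMap.det (A.toLinearEquiv : W →ₗ[ℝ] W) with hd
  have hdet : d ≠ 0 := (LinearEquiv.isUnit_det' A.toLinearEquiv).ne_zero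
  rw [Real.fourier_eq, Real.fourier_eq]
  set G : W → ℂ := fun p => 𝐞 (-⟪p, x⟫_ℝ) • φ (A.symm p) with hG
  -- ∫ G (A v) dv = |d|⁻¹ ∫ G
  have hmap : Measure.map (fun v : W => A v) volume = ENNReal.ofReal |d⁻¹| • (volume : Measure W) := by
    have := Measure.map_linearMap_addHaar_eq_smul_addHaar (volume : Measure W) (f := (A.toLinearEquiv : W →ₗ[ℝ] W)) hdet
    simpa using this
  have hcomp : ∫ v, G (A v) = |d⁻¹| * ∫ p, G p := by
    have h1 : ∫ v, G (A v) = ∫ p, G p ∂(Measure.map (fun v : W => A v) volume) := by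
      have h := integral_map_equiv (μ := (volume : Measure W)) (A.toHomeomorph.toMeasurableEquiv) G
      simp only [Homeomorph.toMeasurableEquiv_coe, ContinuousLinearEquiv.coe_toHomeomorph] at h
      exact h.symm
    rw [h1, hmap, integral_smul_measure, ENNReal.toReal_ofReal (abs_nonneg _)]
    rfl
  have hG2 : ∀ v, G (A v) = 𝐞 (-⟪v, A x⟫_ℝ) • φ v := by
    intro v
    simp only [hG, ContinuousLinearEquiv.symm_apply_apply, hA]
  have habs : |d⁻¹| * |d| = 1 := by rw [abs_inv, inv_mul_cancel₀ (abs_ne_zero.mpr hdet)]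
  calc ∫ p, G p = ((|d| : ℝ) : ℂ) * ∫ v, G (A v) := by
        rw [hcomp, ← mul_assoc]
        rw [show ((|d| : ℝ) : ℂ) * ((|d⁻¹| : ℝ) : ℂ) = 1 by
          rw [← Complex.ofReal_mul, mul_comm, habs, Complex.ofReal_one], one_mul]
    _ = ((|d| : ℝ) : ℂ) * ∫ v, 𝐞 (-⟪v, A x⟫_ℝ) • φ v := by simp_rw [hG2]

end Fourier2

/-! ## §3 Coordinates on `ℝ⁴ = ℝ × ℝ³` and the anisotropic scaling -/

/-- Euclidean momentum / position space `ℝ⁴` (index `0` = the time direction `p₀`). [cite: MagnenRivasseauSeneor1993, §II.B (II.21a) p.335] -/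
abbrev E4 : Type := EuclideanSpace ℝ (Fin 4)
/-- Euclidean `ℝ³` (the spatial directions `p⃗`, «|x⃗ − y⃗|» of (VII.1)). [cite: MagnenRivasseauSeneor1993, §VII (VII.1) p.375] -/
abbrev E3 : Type := EuclideanSpace ℝ (Fin 3)

/-- time component `p₀`. [cite: MagnenRivasseauSeneor1993, §II.B (II.21a) p.335] -/
def timeC (p : E4) : ℝ := p 0

/-- spatial part `p⃗ = (p₁, p₂, p₃)`. [cite: MagnenRivasseauSeneor1993, §II.B (II.21a) p.335] -/
def spat (p : E4) : E3 := WithLp.toLp 2 (fun j : Fin 3 => p j.succ)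

/-- components of `p⃗`. [cite: MagnenRivasseauSeneor1993, §II.B (II.21a) p.335] -/
@[simp] theorem spat_apply (p : E4) (j : Fin 3) : spat p j = p j.succ := rfl

/-- `|p|² = p₀² + |p⃗|²`. [cite: MagnenRivasseauSeneor1993, §II.B p.334 tl.46–47] -/
theorem norm_sq_eq (p : E4) : ‖p‖ ^ 2 = timeC p ^ 2 + ‖spat p‖ ^ 2 := by
  rw [EuclideanSpace.norm_sq_eq, EuclideanSpace.norm_sq_eq, Fin.sum_univ_succ]
  simp [timeC, spat]

/-- `|p₀| ≤ |p|`. [cite: MagnenRivasseauSeneor1993, §II.B p.334 tl.46–47] -/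
theorem abs_timeC_le_norm (p : E4) : |timeC p| ≤ ‖p‖ := by
  have h := norm_sq_eq p
  exact abs_le_of_sq_le_sq (by nlinarith [norm_nonneg (spat p)]) (norm_nonneg p)

/-- `|p⃗| ≤ |p|`. [cite: MagnenRivasseauSeneor1993, §II.B p.334 tl.46–47] -/
theorem norm_spat_le_norm (p : E4) : ‖spat p‖ ≤ ‖p‖ := by
  have h := norm_sq_eq p
  have := abs_le_of_sq_le_sq (a := ‖spat p‖) (b := ‖p‖) (by nlinarith [sq_nonneg (timeC p)]) (norm_nonneg p)
  rwa [abs_of_nonneg (norm_nonneg _)] at this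

/-- the embedding `(z₀, z⃗) ↦ (z₀, z₁, z₂, z₃)` of `ℝ × ℝ³` in `ℝ⁴` (`z = x − y = (x₀ − y₀, x⃗ − y⃗)` of (VII.1)). [cite: MagnenRivasseauSeneor1993, §VII (VII.1) p.375] -/
def emb (z : ℝ × E3) : E4 := WithLp.toLp 2 (Fin.cons z.1 (fun j : Fin 3 => z.2 j))

/-- time component of the embedding. [cite: MagnenRivasseauSeneor1993, §VII (VII.1) p.375] -/
@[simp] theorem timeC_emb (z : ℝ × E3) : timeC (emb z) = z.1 := by simp [timeC, emb]

/-- spatial part of the embedding. [cite: MagnenRivasseauSeneor1993, §VII (VII.1) p.375] -/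
@[simp] theorem spat_emb (z : ℝ × E3) : spat (emb z) = z.2 := by
  ext j; simp [spat, emb]

/-- the diagonal weights `(a, b, b, b)` of the anisotropic scaling. [cite: MagnenRivasseauSeneor1993, §VII (VII.1) p.375] -/
def diagW (a b : ℝ) : Fin 4 → ℝ := Fin.cons a (fun _ : Fin 3 => b)

/-- time weight. [cite: MagnenRivasseauSeneor1993, §VII (VII.1) p.375] -/
@[simp] theorem diagW_zero (a b : ℝ) : diagW a b 0 = a := rfl
/-- space weights. [cite: MagnenRivasseauSeneor1993, §VII (VII.1) p.375] -/
@[simp] theorem diagW_succ (a b : ℝ) (j : Fin 3) : diagW a b j.succ = b := rfl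

/-- the anisotropic scaling `(p₀, p⃗) ↦ (a p₀, b p⃗)` as a linear map of `ℝ⁴` (`a = M^α`, `b = M^i`: the two decay rates of (VII.1)). [cite: MagnenRivasseauSeneor1993, §VII (VII.1) p.375] -/
def scaleₗ (a b : ℝ) : E4 →ₗ[ℝ] E4 :=
  ((WithLp.linearEquiv 2 ℝ (Fin 4 → ℝ)).symm : (Fin 4 → ℝ) →ₗ[ℝ] E4) ∘ₗ
    (Matrix.toLin' (Matrix.diagonal (diagW a b))) ∘ₗ
      ((WithLp.linearEquiv 2 ℝ (Fin 4 → ℝ)) : E4 →ₗ[ℝ] (Fin 4 → ℝ))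

/-- the anisotropic scaling as a continuous linear map. [cite: MagnenRivasseauSeneor1993, §VII (VII.1) p.375] -/
def scale (a b : ℝ) : E4 →L[ℝ] E4 := LinearMap.toContinuousLinearMap (scaleₗ a b)

/-- coordinates of the scaling. [cite: MagnenRivasseauSeneor1993, §VII (VII.1) p.375] -/
theorem scale_apply (a b : ℝ) (p : E4) (i : Fin 4) : scale a b p i = diagW a b i * p i := by
  simp [scale, scaleₗ, Matrix.mulVec_diagonal]

/-- time component of the scaling. [cite: MagnenRivasseauSeneor1993, §VII (VII.1) p.375] -/
@[simp] theorem timeC_scale (a b : ℝ) (p : E4) : timeC (scale a b p) = a * timeC p := by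
  simp [timeC, scale_apply]

/-- spatial part of the scaling. [cite: MagnenRivasseauSeneor1993, §VII (VII.1) p.375] -/
@[simp] theorem spat_scale (a b : ℝ) (p : E4) : spat (scale a b p) = b • spat p := by
  ext j; simp [spat, scale_apply]

/-- `det (p₀, p⃗) ↦ (a p₀, b p⃗) = a b³` (the Jacobian `M^{α+3i}` of the rescaling). [cite: MagnenRivasseauSeneor1993, §VII (VII.1) p.375] -/
theorem det_scale (a b : ℝ) : LinearMap.det (scale a b : E4 →ₗ[ℝ] E4) = a * b ^ 3 := by
  have h1 : (scale a b : E4 →ₗ[ℝ] E4) = scaleₗ a b := rfl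
  rw [h1, scaleₗ]
  rw [show ((WithLp.linearEquiv 2 ℝ (Fin 4 → ℝ)).symm : (Fin 4 → ℝ) →ₗ[ℝ] E4) ∘ₗ
      (Matrix.toLin' (Matrix.diagonal (diagW a b))) ∘ₗ ((WithLp.linearEquiv 2 ℝ (Fin 4 → ℝ)) : E4 →ₗ[ℝ] (Fin 4 → ℝ))
      = ((WithLp.linearEquiv 2 ℝ (Fin 4 → ℝ)).symm : (Fin 4 → ℝ) →ₗ[ℝ] E4) ∘ₗ
      (Matrix.toLin' (Matrix.diagonal (diagW a b))) ∘ₗ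
        (((WithLp.linearEquiv 2 ℝ (Fin 4 → ℝ)).symm.symm : E4 →ₗ[ℝ] (Fin 4 → ℝ))) from rfl,
    LinearMap.det_conj, LinearMap.det_toLin', Matrix.det_diagonal]
  simp [Fin.prod_univ_succ, diagW]

/-- the scaling is self-adjoint. [cite: MagnenRivasseauSeneor1993, §VII (VII.1) p.375] -/
theorem inner_scale_comm (a b : ℝ) (u v : E4) : ⟪scale a b u, v⟫_ℝ = ⟪u, scale a b v⟫_ℝ := by
  simp only [PiLp.inner_apply, scale_apply, RCLike.inner_apply, conj_trivial]
  refine Finset.sum_congr rfl (fun i _ => by ring)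

/-- `|(a z₀)| = |a||z₀|`, `|b z⃗| = |b||z⃗|` — the two printed rates `|x₀ − y₀|M^α`, `|x⃗ − y⃗|M^i`. [cite: MagnenRivasseauSeneor1993, §VII (VII.1) p.375] -/
theorem norm_scale_emb (a b : ℝ) (z : ℝ × E3) :
    |timeC (scale a b (emb z))| = |a| * |z.1| ∧ ‖spat (scale a b (emb z))‖ = |b| * ‖z.2‖ := by
  constructor
  · simp [abs_mul]
  · simp [norm_smul]

/-- `(ε, v) ↦ (ε v₀, v⃗)` is jointly smooth. [cite: MagnenRivasseauSeneor1993, §VII (VII.1) p.375] -/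
theorem contDiff_scale_uncurry (n : ℕ∞) :
    ContDiff ℝ n (fun q : ℝ × E4 => scale q.1 1 q.2) := by
  rw [contDiff_euclidean]
  intro i
  simp_rw [scale_apply]
  refine Fin.cases ?_ (fun j => ?_) i
  · simp only [diagW_zero]
    exact contDiff_fst.mul ((contDiff_piLp_apply (𝕜 := ℝ) (p := 2) (i := (0 : Fin 4))).comp contDiff_snd)
  · simp only [diagW_succ, one_mul]
    exact (contDiff_piLp_apply (𝕜 := ℝ) (p := 2) (i := j.succ)).comp contDiff_snd


/-! ## §4 The unit-scale profiles of MRS's slices and the scaled family -/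

section Profiles

variable (P : Ansatz.CutoffProfile) (η M : ℝ)

/-- The unit-scale slice profile `ψ(u) = κ(u) − κ(Mu)`: for `i ≥ 1` the momentum slice (II.15) is
`κ^i(r) = κ(rM^{−i}) − κ(rM^{−(i−1)}) = ψ(rM^{−i})`, one profile for all `i ≥ 1`.
[cite: MagnenRivasseauSeneor1993, (II.13)–(II.15) p.331] -/
def unitSlice (u : ℝ) : ℝ := Ansatz.cutoffFn P η u - Ansatz.cutoffFn P η (u * M)

/-- (II.15) for `i ≥ 1` as a dilate of the unit profile: `κ^{i+1}(r) = ψ(r / M^{i+1})`.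
[cite: MagnenRivasseauSeneor1993, (II.13)–(II.15) p.331] -/
theorem sliceCutoff_succ_eq_unitSlice (hM : 0 < M) (i : ℕ) (r : ℝ) :
    Ansatz.sliceCutoff P η M (i + 1) r = unitSlice P η M (r * (M ^ (i + 1))⁻¹) := by
  rw [Ansatz.sliceCutoff_succ, unitSlice, Ansatz.scaledCutoff, Ansatz.scaledCutoff]
  have h1 : (M ^ (-((i + 1 : ℕ) : ℤ))) = (M ^ (i + 1))⁻¹ := by
    rw [zpow_neg, zpow_natCast]
  have h2 : r * (M ^ (i + 1))⁻¹ * M = r * M ^ (-(i : ℤ)) := by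
    rw [zpow_neg, zpow_natCast, pow_succ, mul_inv, mul_assoc, mul_assoc, inv_mul_cancel₀ hM.ne', mul_one]
  rw [h1, h2]

/-- `ψ` vanishes near `0`: `ψ(u) = 0` for `u ≤ M⁻¹` (`M ≥ 1`). [cite: MagnenRivasseauSeneor1993, (II.14)–(II.15) p.331] -/
theorem unitSlice_eq_zero_of_le (hM : 1 ≤ M) {u : ℝ} (hu : u ≤ M⁻¹) : unitSlice P η M u = 0 := by
  have hM0 : 0 < M := by linarith
  have h1 : u ≤ 1 := hu.trans (inv_le_one_of_one_le₀ hM)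
  have h2 : u * M ≤ 1 := by
    calc u * M ≤ M⁻¹ * M := mul_le_mul_of_nonneg_right hu hM0.le
      _ = 1 := inv_mul_cancel₀ hM0.ne'
  rw [unitSlice, Ansatz.cutoffFn_of_le_one P η h1, Ansatz.cutoffFn_of_le_one P η h2, sub_self]

/-- `ψ` vanishes beyond `3 + η⁻¹` (`M ≥ 1`, `η > 0`). [cite: MagnenRivasseauSeneor1993, (II.14)–(II.15) p.331] -/
theorem unitSlice_eq_zero_of_ge (hη : 0 < η) (hM : 1 ≤ M) {u : ℝ} (hu : 3 + η⁻¹ ≤ u) :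
    unitSlice P η M u = 0 := by
  have hu0 : 0 ≤ u := by have := inv_pos.mpr hη; linarith
  have h2 : 3 + η⁻¹ ≤ u * M := hu.trans (le_mul_of_one_le_right hu0 hM)
  rw [unitSlice, Ansatz.cutoffFn_eq_zero_of_le P η hη hu, Ansatz.cutoffFn_eq_zero_of_le P η hη h2, sub_self]

/-- `ψ` is smooth. [cite: MagnenRivasseauSeneor1993, (II.14)–(II.15) p.331] -/
theorem contDiff_unitSlice (hη : 0 < η) (n : ℕ∞) : ContDiff ℝ n (unitSlice P η M) :=
  (Ansatz.contDiff_cutoffFn P hη n).sub ((Ansatz.contDiff_cutoffFn P hη n).comp (contDiff_id.mul contDiff_const))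

/-- The time-momentum profile of the pair `(i, α)` with bottom index `N = N_i`: the cumulative cutoff `κ` for the
bottom block `α = N_i` ((II.21b)) and for `α = 0` (`κ⁰ = κ₀`, (II.15)), the slice profile `ψ` otherwise ((II.21a)). 
[cite: MagnenRivasseauSeneor1993, (II.21a)–(II.21b) p.335] -/
def timeProfile (N α : ℕ) : ℝ → ℝ :=
  if α = N ∨ α = 0 then Ansatz.cutoffFn P η else unitSlice P η M

/-- The time factor of `κ^{i,α}(p, p₀)` is the dilate `g_{N,α}(|p₀|/M^α)` of the time profile.
[cite: MagnenRivasseauSeneor1993, (II.21a)–(II.21b) p.335] -/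
theorem timeFactor_eq (hM : 0 < M) (N α : ℕ) (r₀ : ℝ) :
    (if α = N then Ansatz.scaledCutoff P η M α r₀ else Ansatz.sliceCutoff P η M α r₀) =
      timeProfile P η M N α (r₀ * (M ^ α)⁻¹) := by
  by_cases hN : α = N
  · rw [if_pos hN, timeProfile, if_pos (Or.inl hN), Ansatz.scaledCutoff, zpow_neg, zpow_natCast]
  · rw [if_neg hN, timeProfile]
    rcases Nat.eq_zero_or_eq_succ_pred α with h0 | hs
    · subst h0
      rw [if_pos (Or.inr rfl), Ansatz.sliceCutoff_zero, Ansatz.scaledCutoff]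
      simp
    · rw [if_neg (by rintro (h | h) <;> omega), hs, sliceCutoff_succ_eq_unitSlice P η M hM]

/-- Both time profiles are smooth, locally constant near `0` and vanish beyond `3 + η⁻¹`.
[cite: MagnenRivasseauSeneor1993, (II.14), (II.21a)–(II.21b) pp.331–335] -/
theorem timeProfile_props (hη : 0 < η) (hM : 1 ≤ M) (N α : ℕ) :
    ContDiff ℝ ∞ (timeProfile P η M N α) ∧
      (∃ δ : ℝ, 0 < δ ∧ ∀ r, r < δ → timeProfile P η M N α r = timeProfile P η M N α 0) ∧
      (∀ r, 3 + η⁻¹ ≤ r → timeProfile P η M N α r = 0) := by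
  unfold timeProfile
  split_ifs with h
  · refine ⟨Ansatz.contDiff_cutoffFn P hη _, ⟨1, one_pos, fun r hr => ?_⟩, fun r hr => Ansatz.cutoffFn_eq_zero_of_le P η hη hr⟩
    rw [Ansatz.cutoffFn_of_le_one P η hr.le, Ansatz.cutoffFn_of_le_one P η zero_le_one]
  · have hM0 : 0 < M := by linarith
    refine ⟨contDiff_unitSlice P η M hη _, ⟨M⁻¹, inv_pos.mpr hM0, fun r hr => ?_⟩,
      fun r hr => unitSlice_eq_zero_of_ge P η M hη hM hr⟩
    rw [unitSlice_eq_zero_of_le P η M hM hr.le, unitSlice_eq_zero_of_le P η M hM (inv_pos.mpr hM0).le]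

end Profiles

/-! ## §5 The scaled family `Φ_{g}(ε, v) = g(|v₀|)·ψ(|(εv₀, v⃗)|)·|(εv₀, v⃗)|⁻²` — joint smoothness, uniform support, uniform Fourier decay -/

section Family

/-- The scaled momentum-space slice: `Φ(ε, v) = g(|v₀|) ψ(‖(εv₀, v⃗)‖) ‖(εv₀, v⃗)‖⁻²` (`g` the time profile, `ψ` the
slice profile; `ε = M^{α−i}` the anisotropy). [cite: MagnenRivasseauSeneor1993, §VII (VII.1) p.375] -/
def fam (g ψ : ℝ → ℝ) (q : ℝ × E4) : ℝ :=
  g |timeC q.2| * ψ ‖scale q.1 1 q.2‖ * (‖scale q.1 1 q.2‖ ^ 2)⁻¹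

variable {g ψ : ℝ → ℝ}

/-- Joint smoothness of the scaled family in `(ε, v)` (the inverse square is smooth off the zero set of `(εv₀, v⃗)`,
near which the slice profile vanishes identically). [cite: MagnenRivasseauSeneor1993, §VII (VII.1) p.375] -/
theorem contDiff_fam (hg : ContDiff ℝ ∞ g) (hg0 : ∃ δ : ℝ, 0 < δ ∧ ∀ r, r < δ → g r = g 0)
    (hψ : ContDiff ℝ ∞ ψ) (hψ0 : ∃ δ : ℝ, 0 < δ ∧ ∀ r, r < δ → ψ r = 0) :
    ContDiff ℝ ∞ (fam g ψ) := by
  obtain ⟨δg, hδg, hg0'⟩ := hg0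
  obtain ⟨δ, hδ, hψ0'⟩ := hψ0
  have hT : ContDiff ℝ ∞ (fun q : ℝ × E4 => scale q.1 1 q.2) := contDiff_scale_uncurry _
  -- the three factors
  have hA : ContDiff ℝ ∞ (fun q : ℝ × E4 => g |timeC q.2|) := by
    have h1 : ContDiff ℝ ∞ (fun s : ℝ => g (1 * ‖s‖)) := Ansatz.contDiff_comp_norm_mul hg hδg hg0' one_pos
    simp only [one_mul, Real.norm_eq_abs] at h1
    have h2 : ContDiff ℝ ∞ (fun q : ℝ × E4 => timeC q.2) :=
      (contDiff_piLp_apply (𝕜 := ℝ) (p := 2) (i := (0 : Fin 4))).comp contDiff_snd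
    exact h1.comp h2
  have hB : ContDiff ℝ ∞ (fun q : ℝ × E4 => ψ ‖scale q.1 1 q.2‖) := by
    have hψ00 : ∀ r, r < δ → ψ r = ψ 0 := fun r hr => by rw [hψ0' r hr, hψ0' 0 hδ]
    have h1 : ContDiff ℝ ∞ (fun p : E4 => ψ (1 * ‖p‖)) := Ansatz.contDiff_comp_norm_mul hψ hδ hψ00 one_pos
    simp only [one_mul] at h1
    exact h1.comp hT
  have hN2 : ContDiff ℝ ∞ (fun q : ℝ × E4 => ‖scale q.1 1 q.2‖ ^ 2) := (contDiff_norm_sq ℝ).comp hT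
  rw [contDiff_iff_contDiffAt]
  intro q
  by_cases hq : scale q.1 1 q.2 = 0
  · -- near `q` the slice factor vanishes identically
    have hopen : IsOpen {q' : ℝ × E4 | ‖scale q'.1 1 q'.2‖ < δ} :=
      isOpen_lt (continuous_norm.comp hT.continuous) continuous_const
    have hmem : q ∈ {q' : ℝ × E4 | ‖scale q'.1 1 q'.2‖ < δ} := by
      show ‖scale q.1 1 q.2‖ < δ
      rw [hq, norm_zero]; exact hδ
    have hev : ∀ᶠ q' in nhds q, fam g ψ q' = 0 := by
      filter_upwards [hopen.mem_nhds hmem] with q' hq'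
      have h0 : ψ ‖scale q'.1 1 q'.2‖ = 0 := hψ0' _ hq'
      simp only [fam, h0, mul_zero, zero_mul]
    exact (contDiffAt_const (c := (0 : ℝ))).congr_of_eventuallyEq hev
  · have hne : ‖scale q.1 1 q.2‖ ^ 2 ≠ 0 := pow_ne_zero 2 (norm_ne_zero_iff.mpr hq)
    exact (hA.contDiffAt.mul hB.contDiffAt).mul (hN2.contDiffAt.inv hne)

/-- Uniform support: for EVERY `ε`, `Φ(ε, ·)` is supported in the ball of radius `2R₀` when both profiles vanish
beyond `R₀ ≥ 0` (the time profile bounds `|v₀|`, the slice profile bounds `‖v⃗‖ ≤ ‖(εv₀, v⃗)‖`).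
[cite: MagnenRivasseauSeneor1993, §VII (VII.1) p.375] -/
theorem support_fam_subset {R₀ : ℝ} (hR₀ : 0 ≤ R₀) (hgR : ∀ r, R₀ ≤ r → g r = 0) (hψR : ∀ r, R₀ ≤ r → ψ r = 0)
    (ε : ℝ) : Function.support (fun v => fam g ψ (ε, v)) ⊆ Metric.closedBall (0 : E4) (2 * R₀) := by
  intro v hv
  rw [Function.mem_support, fam] at hv
  have h1 : g |timeC v| ≠ 0 := fun h => hv (by simp [h])
  have h2 : ψ ‖scale ε 1 v‖ ≠ 0 := fun h => hv (by simp [h])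
  have ht : |timeC v| < R₀ := lt_of_not_ge (fun h => h1 (hgR _ h))
  have hs' : ‖scale ε 1 v‖ < R₀ := lt_of_not_ge (fun h => h2 (hψR _ h))
  have hs : ‖spat v‖ < R₀ := by
    have := norm_spat_le_norm (scale ε 1 v)
    rw [spat_scale, one_smul] at this
    exact this.trans_lt hs'
  rw [Metric.mem_closedBall, dist_zero_right]
  have hsq := norm_sq_eq v
  nlinarith [abs_nonneg (timeC v), norm_nonneg (spat v), norm_nonneg v, sq_abs (timeC v)]

/-- Casting the family to `ℂ` (the integrand of the Fourier integral). [cite: MagnenRivasseauSeneor1993, §VII (VII.1) p.375] -/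
def famC (g ψ : ℝ → ℝ) (ε : ℝ) (v : E4) : ℂ := ((fam g ψ (ε, v) : ℝ) : ℂ)

/-- **Uniform Fourier decay of the scaled family**: for every compact set `S` of anisotropies and every `n` there
is ONE constant `K` with `|𝓕[Φ(ε, ·)](w)| ≤ K(1 + |w|)^{−n}` for all `ε ∈ S` and all `w` (smoothness + compact
support uniform in `ε`, then integration by parts). [cite: MagnenRivasseauSeneor1993, §VII (VII.1) p.375; §II.B p.336 tl.2–3] -/
theorem exists_fourier_famC_le (hg : ContDiff ℝ ∞ g) (hg0 : ∃ δ : ℝ, 0 < δ ∧ ∀ r, r < δ → g r = g 0)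
    (hψ : ContDiff ℝ ∞ ψ) (hψ0 : ∃ δ : ℝ, 0 < δ ∧ ∀ r, r < δ → ψ r = 0)
    {R₀ : ℝ} (hR₀ : 0 ≤ R₀) (hgR : ∀ r, R₀ ≤ r → g r = 0) (hψR : ∀ r, R₀ ≤ r → ψ r = 0)
    {S : Set ℝ} (hS : IsCompact S) (n : ℕ) :
    ∃ K : ℝ, 0 ≤ K ∧ ∀ ε ∈ S, ∀ w : E4, ‖𝓕 (famC g ψ ε) w‖ ≤ K * ((1 + ‖w‖) ^ n)⁻¹ := by
  have hΦ := contDiff_fam hg hg0 hψ hψ0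
  have hsupp := support_fam_subset hR₀ hgR hψR (g := g) (ψ := ψ)
  -- one derivative bound for all orders m ≤ n, all ε ∈ S
  choose B hB0 hB using fun m : ℕ =>
    exists_uniform_bound_iteratedFDeriv (F := ℝ) hΦ hS (fun ε _ => hsupp ε) (m := m) le_top
  set Bs : ℝ := ∑ m ∈ Finset.range (n + 1), B m with hBs
  have hBs0 : 0 ≤ Bs := Finset.sum_nonneg (fun m _ => hB0 m)
  have hBle : ∀ m, m ≤ n → B m ≤ Bs := fun m hm =>
    Finset.single_le_sum (f := B) (fun m _ => hB0 m) (Finset.mem_range.mpr (Nat.lt_succ_of_le hm))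
  set VR : ℝ := (volume (Metric.closedBall (0 : E4) (2 * R₀))).toReal
  refine ⟨4 ^ n * (n + 2) * Bs * VR, by positivity, fun ε hε w => ?_⟩
  have hfC : ContDiff ℝ n (famC g ψ ε) :=
    Complex.ofRealCLM.contDiff.comp ((hΦ.comp (contDiff_const.prodMk contDiff_id)).of_le (by exact_mod_cast le_top))
  have hsuppC : Function.support (famC g ψ ε) ⊆ Metric.closedBall (0 : E4) (2 * R₀) := by
    intro v hv
    apply hsupp ε
    rw [Function.mem_support] at hv ⊢
    exact fun h => hv (by simp [famC, h])
  have hboundC : ∀ m, m ≤ n → ∀ v, ‖iteratedFDeriv ℝ m (famC g ψ ε) v‖ ≤ Bs := by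
    intro m hm v
    have hreal : ContDiff ℝ ∞ (fun v => fam g ψ (ε, v)) := hΦ.comp (contDiff_const.prodMk contDiff_id)
    have heq : ‖iteratedFDeriv ℝ m (famC g ψ ε) v‖ = ‖iteratedFDeriv ℝ m (fun v => fam g ψ (ε, v)) v‖ := by
      exact LinearIsometry.norm_iteratedFDeriv_comp_left (Complex.ofRealLI) (hreal.contDiffAt (x := v)) (i := m)
        (by exact_mod_cast le_top)
    rw [heq]
    exact (hB m ε hε v).trans (hBle m hm)
  exact norm_fourier_le_of_iteratedFDeriv_le hfC hBs0 hsuppC hboundC w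

end Family

/-! ## §6 The small-field slice propagator `C^j = κ^j(p)/p²` of Sect. VII and the estimate (VII.1), PROVED -/

section Kernel

/-- The anisotropic scaling as a continuous linear automorphism (`a, b ≠ 0`).
[cite: MagnenRivasseauSeneor1993, §VII (VII.1) p.375] -/
def scaleEquiv (a b : ℝ) (ha : a ≠ 0) (hb : b ≠ 0) : E4 ≃L[ℝ] E4 :=
  ContinuousLinearEquiv.equivOfInverse (scale a b) (scale a⁻¹ b⁻¹)
    (fun p => by
      ext i
      rw [scale_apply, scale_apply]
      refine Fin.cases ?_ (fun j => ?_) i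
      · simp [inv_mul_cancel_left₀ ha]
      · simp [inv_mul_cancel_left₀ hb])
    (fun p => by
      ext i
      rw [scale_apply, scale_apply]
      refine Fin.cases ?_ (fun j => ?_) i
      · simp [mul_inv_cancel_left₀ ha]
      · simp [mul_inv_cancel_left₀ hb])

/-- the automorphism acts as `scale a b`. [cite: MagnenRivasseauSeneor1993, §VII (VII.1) p.375] -/
@[simp] theorem scaleEquiv_apply (a b : ℝ) (ha : a ≠ 0) (hb : b ≠ 0) (p : E4) :
    scaleEquiv a b ha hb p = scale a b p := rfl

/-- `(a p₀, b p⃗) = b·((a/b) p₀, p⃗)`: the anisotropy `ε = a/b = M^{α−i}`. [cite: MagnenRivasseauSeneor1993, §VII (VII.1) p.375] -/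
theorem scale_eq_smul {a b : ℝ} (hb : b ≠ 0) (v : E4) : scale a b v = b • scale (a / b) 1 v := by
  ext i
  rw [PiLp.smul_apply, scale_apply, scale_apply, smul_eq_mul]
  refine Fin.cases ?_ (fun j => ?_) i
  · simp only [diagW_zero]; field_simp
  · simp only [diagW_succ]; ring

/-- `𝓕` is linear over real constants (in the form used below). [folklore] -/
private theorem fourier_const_mul (c : ℝ) (f : E4 → ℂ) (x : E4) :
    𝓕 (fun p => (c : ℂ) * f p) x = (c : ℂ) * 𝓕 f x := by
  rw [Real.fourier_eq, Real.fourier_eq, ← integral_const_mul]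
  congr 1; funext v
  simp only [Circle.smul_def]; ring

variable (P : Ansatz.CutoffProfile) (η M : ℝ) (N : ℕ → ℕ)

/-- **The small-field propagator in the slice `j = (i, α)`, momentum space**: *«let us pretend the small field propagator
to be simply 1/p². The same propagator in the slice j would then be C^j = κ^j(p)/p²»* — with MRS's anisotropic slice
`κ^j(p) = κ^{i,α}(|p|, |p₀|)` of (II.21a)–(II.21b) (`Ansatz.anisoSlice`, bottom index `N_i = N i`) and `p² = |p|²` the
Euclidean 4-momentum squared. [cite: MagnenRivasseauSeneor1993, §VII p.375 tl.8–11] -/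
def sliceMom (i α : ℕ) (p : E4) : ℝ :=
  Ansatz.anisoSlice P η M (N i) i α ‖p‖ |timeC p| / ‖p‖ ^ 2

/-- **The small-field propagator in the slice `j = (i, α)`, position space**: `C^j(x − y)`, the Fourier transform of
`κ^j(p)/p²` evaluated at `z = x − y = (z₀, z⃗) ∈ ℝ × ℝ³` (Mathlib's convention `𝓕f(z) = ∫ e^{−2πi p·z} f(p) d⁴p`; real
part — the imaginary part vanishes by `p ↦ −p` symmetry, not used). [cite: MagnenRivasseauSeneor1993, §VII (VII.1) p.375] -/
def sliceKernel (i α : ℕ) (z : ℝ × E3) : ℝ :=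
  (𝓕 (fun p : E4 => ((sliceMom P η M N i α p : ℝ) : ℂ)) (emb z)).re

variable {P η M N}

/-- The exact anisotropic scaling of the momentum-space slice: for `i = k + 1`, `a = M^α`, `b = M^{i}`,
`C^j(a v₀, b v⃗) = b^{−2} · Φ_{g}(a/b, v)` with the time profile `g = g_{N_i, α}` and the slice profile `ψ`.
[cite: MagnenRivasseauSeneor1993, §VII (VII.1) p.375; (II.13)–(II.15) p.331, (II.21a)–(II.21b) p.335] -/
theorem sliceMom_scale (hM : 0 < M) (k α : ℕ) (v : E4) :
    sliceMom P η M N (k + 1) α (scale (M ^ α) (M ^ (k + 1)) v) =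
      ((M ^ (k + 1)) ^ 2)⁻¹ *
        fam (timeProfile P η M (N (k + 1)) α) (unitSlice P η M) (M ^ α / M ^ (k + 1), v) := by
  set a : ℝ := M ^ α with ha
  set b : ℝ := M ^ (k + 1) with hb
  have ha0 : 0 < a := pow_pos hM _
  have hb0 : 0 < b := pow_pos hM _
  have hsm : scale a b v = b • scale (a / b) 1 v := scale_eq_smul hb0.ne' v
  have hnorm : ‖scale a b v‖ = b * ‖scale (a / b) 1 v‖ := by
    rw [hsm, norm_smul, Real.norm_eq_abs, abs_of_pos hb0]
  have htime : |timeC (scale a b v)| * a⁻¹ = |timeC v| := by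
    rw [timeC_scale, abs_mul, abs_of_pos ha0]
    field_simp
  rw [sliceMom, Ansatz.anisoSlice, timeFactor_eq P η M hM, htime, sliceCutoff_succ_eq_unitSlice P η M hM, ← hb,
    hnorm, fam]
  have h1 : b * ‖scale (a / b) 1 v‖ * b⁻¹ = ‖scale (a / b) 1 v‖ := by field_simp
  rw [h1]
  simp only
  rw [mul_pow, div_eq_mul_inv, mul_inv]
  ring

/-- **(VII.1) for the kernel, with explicit structure**: for `η > 0`, `M > 1` and every `q` there is `K_q` (depending on
`q`, `M`, `η` and the cutoff profile only — not on `i`, `α`, `N`) such that for all `i ≥ 1`, all `α ≤ i + 1` and all `z`,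
`|C^{(i,α)}(z)| ≤ K_q M^i M^α (1 + |z₀|M^α)^{−q} (1 + |z⃗|M^i)^{−q}`.
[cite: MagnenRivasseauSeneor1993, §VII (VII.1) p.375 tl.8–13] -/
theorem exists_sliceKernel_bound (hη : 0 < η) (hM : 1 < M) (q : ℕ) :
    ∃ Kq : ℝ, 0 ≤ Kq ∧ ∀ (N : ℕ → ℕ) (k α : ℕ), α ≤ k + 2 → ∀ z : ℝ × E3,
      |sliceKernel P η M N (k + 1) α z| ≤
        Kq * M ^ (k + 1) * M ^ α * (1 / (1 + |z.1| * M ^ α) * (1 / (1 + ‖z.2‖ * M ^ (k + 1)))) ^ q := by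
  have hM0 : 0 < M := by linarith
  have hM1 : 1 ≤ M := hM.le
  set R₀ : ℝ := 3 + η⁻¹ with hR₀
  have hR₀0 : 0 ≤ R₀ := by have := inv_pos.mpr hη; positivity
  have hS : IsCompact (Set.Icc (0 : ℝ) M) := isCompact_Icc
  -- the slice profile ψ
  have hψ : ContDiff ℝ ∞ (unitSlice P η M) := contDiff_unitSlice P η M hη _
  have hψ0 : ∃ δ : ℝ, 0 < δ ∧ ∀ r, r < δ → unitSlice P η M r = 0 :=
    ⟨M⁻¹, inv_pos.mpr hM0, fun r hr => unitSlice_eq_zero_of_le P η M hM1 hr.le⟩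
  have hψR : ∀ r, R₀ ≤ r → unitSlice P η M r = 0 := fun r hr => unitSlice_eq_zero_of_ge P η M hη hM1 hr
  -- one Fourier constant for every time profile g_{N,α}
  have hK : ∃ K : ℝ, 0 ≤ K ∧ ∀ (Nv α : ℕ), ∀ ε ∈ Set.Icc (0 : ℝ) M, ∀ w : E4,
      ‖𝓕 (famC (timeProfile P η M Nv α) (unitSlice P η M) ε) w‖ ≤ K * ((1 + ‖w‖) ^ (2 * q))⁻¹ := by
    obtain ⟨K₁, hK₁0, hK₁⟩ := exists_fourier_famC_le (g := Ansatz.cutoffFn P η) (ψ := unitSlice P η M)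
      (Ansatz.contDiff_cutoffFn P hη _) ⟨1, one_pos, fun r hr => by
        rw [Ansatz.cutoffFn_of_le_one P η hr.le, Ansatz.cutoffFn_of_le_one P η zero_le_one]⟩
      hψ hψ0 hR₀0 (fun r hr => Ansatz.cutoffFn_eq_zero_of_le P η hη hr) hψR hS (2 * q)
    obtain ⟨K₂, hK₂0, hK₂⟩ := exists_fourier_famC_le (g := unitSlice P η M) (ψ := unitSlice P η M)
      hψ ⟨M⁻¹, inv_pos.mpr hM0, fun r hr => by
        rw [unitSlice_eq_zero_of_le P η M hM1 hr.le, unitSlice_eq_zero_of_le P η M hM1 (inv_pos.mpr hM0).le]⟩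
      hψ hψ0 hR₀0 hψR hψR hS (2 * q)
    refine ⟨max K₁ K₂, le_max_of_le_left hK₁0, fun Nv α ε hε w => ?_⟩
    unfold timeProfile
    split_ifs
    · exact (hK₁ ε hε w).trans (mul_le_mul_of_nonneg_right (le_max_left _ _) (by positivity))
    · exact (hK₂ ε hε w).trans (mul_le_mul_of_nonneg_right (le_max_right _ _) (by positivity))
  obtain ⟨K, hK0, hK⟩ := hK
  refine ⟨K, hK0, fun N k α hα z => ?_⟩
  set a : ℝ := M ^ α with ha
  set b : ℝ := M ^ (k + 1) with hb
  have ha0 : 0 < a := pow_pos hM0 _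
  have hb0 : 0 < b := pow_pos hM0 _
  set ε : ℝ := a / b with hε
  have hεS : ε ∈ Set.Icc (0 : ℝ) M := by
    refine ⟨div_nonneg ha0.le hb0.le, ?_⟩
    rw [hε, div_le_iff₀ hb0, ha, hb, ← pow_succ']
    exact pow_le_pow_right₀ hM1 (by omega)
  set g := timeProfile P η M (N (k + 1)) α with hg
  set ψ := unitSlice P η M with hψdef
  set A := scaleEquiv a b ha0.ne' hb0.ne' with hA
  -- momentum side: C^j = b⁻² Φ(ε, A⁻¹ ·)
  have hmom : (fun p : E4 => ((sliceMom P η M N (k + 1) α p : ℝ) : ℂ)) =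
      fun p => (((b ^ 2)⁻¹ : ℝ) : ℂ) * famC g ψ ε (A.symm p) := by
    funext p
    have hp : scale a b (A.symm p) = p := by
      rw [hA]; exact (scaleEquiv a b ha0.ne' hb0.ne').apply_symm_apply p
    rw [famC, ← Complex.ofReal_mul]
    congr 1
    have h := sliceMom_scale (P := P) (η := η) (N := N) hM0 k α (A.symm p)
    rw [← ha, ← hb, ← hε, ← hψdef, ← hg, hp] at h
    exact h
  -- Fourier side
  have hdet : LinearMap.det (A.toLinearEquiv : E4 →ₗ[ℝ] E4) = a * b ^ 3 := by
    rw [show (A.toLinearEquiv : E4 →ₗ[ℝ] E4) = (scale a b : E4 →ₗ[ℝ] E4) from rfl, det_scale]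
  have hF : 𝓕 (fun p : E4 => ((sliceMom P η M N (k + 1) α p : ℝ) : ℂ)) (emb z) =
      (((b ^ 2)⁻¹ * |a * b ^ 3| : ℝ) : ℂ) * 𝓕 (famC g ψ ε) (A (emb z)) := by
    have hAsym : ∀ u v : E4, ⟪A u, v⟫_ℝ = ⟪u, A v⟫_ℝ := fun u v => by
      rw [hA, scaleEquiv_apply, scaleEquiv_apply, inner_scale_comm]
    have h1 : 𝓕 (fun p : E4 => (((b ^ 2)⁻¹ : ℝ) : ℂ) * famC g ψ ε (A.symm p)) (emb z) =
        (((b ^ 2)⁻¹ : ℝ) : ℂ) * 𝓕 (fun p => famC g ψ ε (A.symm p)) (emb z) :=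
      fourier_const_mul _ (fun p => famC g ψ ε (A.symm p)) _
    have h2 : 𝓕 (fun p => famC g ψ ε (A.symm p)) (emb z) =
        (((|LinearMap.det (A.toLinearEquiv : E4 →ₗ[ℝ] E4)| : ℝ)) : ℂ) * 𝓕 (famC g ψ ε) (A (emb z)) :=
      fourier_comp_symm A hAsym (famC g ψ ε) (emb z)
    rw [hmom, h1, h2, hdet, ← mul_assoc, ← Complex.ofReal_mul]
  have hcoef : (b ^ 2)⁻¹ * |a * b ^ 3| = a * b := by
    rw [abs_of_pos (by positivity)]
    field_simp
  -- the decay factor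
  have hAz : A (emb z) = scale a b (emb z) := rfl
  have ht : a * |z.1| ≤ ‖A (emb z)‖ := by
    have h := abs_timeC_le_norm (scale a b (emb z))
    rw [(norm_scale_emb a b z).1, abs_of_pos ha0] at h
    rwa [hAz]
  have hs : b * ‖z.2‖ ≤ ‖A (emb z)‖ := by
    have h := norm_spat_le_norm (scale a b (emb z))
    rw [(norm_scale_emb a b z).2, abs_of_pos hb0] at h
    rwa [hAz]
  have hdec : ((1 + ‖A (emb z)‖) ^ (2 * q))⁻¹ ≤ (1 / (1 + |z.1| * a) * (1 / (1 + ‖z.2‖ * b))) ^ q := by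
    rw [mul_pow, one_div, one_div, inv_pow, inv_pow, ← mul_inv]
    have h1 : 0 < (1 + |z.1| * a) ^ q * (1 + ‖z.2‖ * b) ^ q := by positivity
    refine inv_anti₀ h1 ?_
    rw [two_mul, pow_add]
    refine mul_le_mul (pow_le_pow_left₀ (by positivity) (by linarith [mul_comm a |z.1|]) q)
      (pow_le_pow_left₀ (by positivity) (by linarith [mul_comm b ‖z.2‖]) q) (by positivity) (by positivity)
  rw [sliceKernel, hF, hcoef]
  calc |((((a * b : ℝ)) : ℂ) * 𝓕 (famC g ψ ε) (A (emb z))).re|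
      ≤ ‖(((a * b : ℝ)) : ℂ) * 𝓕 (famC g ψ ε) (A (emb z))‖ := Complex.abs_re_le_norm _
    _ = a * b * ‖𝓕 (famC g ψ ε) (A (emb z))‖ := by
        rw [norm_mul, Complex.norm_real, Real.norm_eq_abs, abs_of_pos (mul_pos ha0 hb0)]
    _ ≤ a * b * (K * ((1 + ‖A (emb z)‖) ^ (2 * q))⁻¹) :=
        mul_le_mul_of_nonneg_left (hK (N (k + 1)) α ε hεS (A (emb z))) (by positivity)
    _ ≤ a * b * (K * (1 / (1 + |z.1| * a) * (1 / (1 + ‖z.2‖ * b))) ^ q) := by gcongr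
    _ = K * b * a * (1 / (1 + |z.1| * a) * (1 / (1 + ‖z.2‖ * b))) ^ q := by ring

end Kernel

/-! ## §7 (VII.1) in the tree's predicate form `Convergence.IneqVII1Printed` -/

section PrintedForm

variable (P : Ansatz.CutoffProfile) (η M : ℝ) (N : ℕ → ℕ)

/-- The (VII.1) kernel family indexed by ALL pairs `(i, α) ∈ ℕ × ℕ`, as the predicate `Convergence.SliceBound` demands:
MRS's `C^j` for the pairs of the index set `𝐏` — `i ≥ 1` (*«For every value of i = 1, …, ρ₁»*, p.334) and `α ≤ i + 1`
(*«α with integer values between N_i and i+1»*) —, extended by `0` to the pairs that label no slice (`i = 0`, `α ≥ i + 2`).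
[cite: MagnenRivasseauSeneor1993, §II.B p.334 tl.44–47; §VII (VII.1) p.375] -/
def kernelFamily (i α : ℕ) (z : ℝ × E3) : ℝ :=
  if 1 ≤ i ∧ α ≤ i + 1 then sliceKernel P η M N i α z else 0

variable {P η M}

/-- **(VII.1) PROVED** in the printed quantifier shape `∀ q, ∃ K_q, ∀ (i, α), ∀ (x − y)` of the tree's predicate
`Convergence.IneqVII1Printed` (file `MRS93ConvergencePowerCounting`, where it was typed AS PRINTED and left unproved):
*«C^j(x − y) ≤ K_q M^i M^α (1/(1 + |x₀ − y₀|M^α) · 1/(1 + |x⃗ − y⃗|M^i))^q (VII.1) for some large integer q»*, for the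
small-field slice propagator `C^j = κ^j(p)/p²` built from MRS's own cutoff (II.14) and anisotropic slices (II.21a/b), every
bottom-index assignment `N`, every `η > 0`, `M > 1`. [cite: MagnenRivasseauSeneor1993, §VII (VII.1) p.375 tl.8–13] -/
theorem ineqVII1Printed_kernelFamily (hη : 0 < η) (hM : 1 < M) (N : ℕ → ℕ) :
    Convergence.IneqVII1Printed (kernelFamily P η M N) M := by
  intro q
  obtain ⟨Kq, hKq0, hKq⟩ := exists_sliceKernel_bound (P := P) hη hM q
  refine ⟨Kq, fun i α z => ?_⟩
  unfold kernelFamily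
  split_ifs with h
  · obtain ⟨hi, hα⟩ := h
    obtain ⟨k, rfl⟩ : ∃ k, i = k + 1 := ⟨i - 1, by omega⟩
    exact hKq N k α (by omega) z
  · rw [abs_zero]
    have hM0 : 0 < M := by linarith
    positivity

/-- The literal «for some large integer q» form follows for every threshold.
[cite: MagnenRivasseauSeneor1993, §VII (VII.1) p.375 tl.13] -/
theorem ineqVII1Printed_exists_kernelFamily (hη : 0 < η) (hM : 1 < M) (N : ℕ → ℕ) (q₀ : ℕ) :
    Convergence.IneqVII1Printed_exists (kernelFamily P η M N) M q₀ :=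
  Convergence.ineqVII1_exists_of_forall (ineqVII1Printed_kernelFamily hη hM N) q₀

/-- For `M ≥ 3 + η⁻¹` (so that the support `|p| < (3 + η⁻¹)M^i` of `κ^i` lies below `M^{i+1}`, as in
`MRS93AnisotropicSlicing` §2) and bottom indices `N_i ≤ i + 1` (MRS: `N_i ≤ i`, `Ansatz.lowIndex_le`), the momentum
slices with `α ≥ i + 2` VANISH identically: the extension by zero in `kernelFamily` off `α ≤ i + 1` changes nothing.
[cite: MagnenRivasseauSeneor1993, §II.B (II.21a)–(II.21b) p.335; (II.13)–(II.15) p.331] -/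
theorem sliceMom_eq_zero_of_le (hη : 0 < η) (hM : 3 + η⁻¹ ≤ M) (hN : ∀ i, N i ≤ i + 1) {k α : ℕ}
    (hα : k + 3 ≤ α) (p : E4) : sliceMom P η M N (k + 1) α p = 0 := by
  have hη' : 0 < η⁻¹ := inv_pos.mpr hη
  have hM1 : 1 ≤ M := by linarith
  have hM0 : 0 < M := by linarith
  rw [sliceMom, Ansatz.anisoSlice_of_ne P η M (by have := hN (k + 1); omega)]
  rcases le_or_gt ((3 + η⁻¹) * M ^ (k + 1)) ‖p‖ with h | h
  · rw [Ansatz.sliceCutoff_succ_eq_zero_of_ge P η M hη hM1 k h, zero_mul, zero_div]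
  · obtain ⟨β, rfl⟩ : ∃ β, α = β + 1 := ⟨α - 1, by omega⟩
    have hp0 : |timeC p| ≤ M ^ β := by
      calc |timeC p| ≤ ‖p‖ := abs_timeC_le_norm p
        _ ≤ (3 + η⁻¹) * M ^ (k + 1) := h.le
        _ ≤ M * M ^ (k + 1) := mul_le_mul_of_nonneg_right hM (by positivity)
        _ = M ^ (k + 2) := by ring
        _ ≤ M ^ β := pow_le_pow_right₀ hM1 (by omega)
    rw [Ansatz.sliceCutoff_succ_eq_zero_of_le P η M hM1 β hp0, mul_zero, zero_div]

/-- Hence, under the same two hypotheses, the UNRESTRICTED family of MRS kernels `C^{(i,α)}` over all `α` (only the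
non-existent scale `i = 0` set to `0`) satisfies (VII.1). [cite: MagnenRivasseauSeneor1993, §VII (VII.1) p.375 tl.8–13] -/
theorem ineqVII1Printed_sliceKernel (hη : 0 < η) (hM : 3 + η⁻¹ ≤ M) (hN : ∀ i, N i ≤ i + 1) :
    Convergence.IneqVII1Printed (fun i α z => if 1 ≤ i then sliceKernel P η M N i α z else 0) M := by
  have hM1 : 1 < M := by have := inv_pos.mpr hη; linarith
  intro q
  obtain ⟨Kq, hKq⟩ := ineqVII1Printed_kernelFamily (P := P) hη hM1 N q
  refine ⟨Kq, fun i α z => ?_⟩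
  have h := hKq i α z
  unfold kernelFamily at h
  beta_reduce
  by_cases hi : 1 ≤ i
  · rw [if_pos hi]
    by_cases hα : α ≤ i + 1
    · rwa [if_pos ⟨hi, hα⟩] at h
    · rw [if_neg (by tauto)] at h
      obtain ⟨k, rfl⟩ : ∃ k, i = k + 1 := ⟨i - 1, by omega⟩
      have h0 : sliceKernel P η M N (k + 1) α z = 0 := by
        rw [sliceKernel]
        have hfun : (fun p : E4 => ((sliceMom P η M N (k + 1) α p : ℝ) : ℂ)) = 0 := by
          funext p
          have hz := sliceMom_eq_zero_of_le (P := P) (k := k) (α := α) N hη hM hN (by omega) p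
          simp [hz]
        rw [hfun, Real.fourier_eq]
        simp
      rwa [h0]
  · rw [if_neg hi]
    rwa [if_neg (by tauto)] at h

end PrintedForm

/-! ## §8 The same bound in the convention `∫ e^{ip·(x−y)} C^j(p) d⁴p` of [R] (III.3.3) -/

section PhysConvention

variable (P : Ansatz.CutoffProfile) (η M : ℝ) (N : ℕ → ℕ)

/-- `C^j(x − y) = ∫ e^{ip·(x−y)} κ^j(p)/p² d⁴p` in the convention of [R] (III.3.3) «C^i = ∫e^{ip(x−y)} η^i(p²)∕p² d⁴p» (no `2π` in
the phase): `= (𝓕 C^j)(−(x−y)/2π)` in Mathlib's convention. [cite: MagnenRivasseauSeneor1993, §VII (VII.1) p.375; Rivasseau1991, §III.3 (III.3.3) p.212] -/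
def sliceKernelPhys (i α : ℕ) (z : ℝ × E3) : ℝ :=
  sliceKernel P η M N i α ((-(2 * Real.pi)⁻¹) • z)

/-- the family over all pairs, phase convention `e^{ip·(x−y)}`, zero off the range of 𝐏 (as `kernelFamily`).
[cite: MagnenRivasseauSeneor1993, §VII (VII.1) p.375] -/
def kernelFamilyPhys (i α : ℕ) (z : ℝ × E3) : ℝ :=
  if 1 ≤ i ∧ α ≤ i + 1 then sliceKernelPhys P η M N i α z else 0

variable {P η M}

/-- `1/(1 + t/(2π)) ≤ 2π/(1 + t)` for `t ≥ 0` (the change of phase convention costs `(2π)^q` per decay factor). [folklore] -/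
private theorem decay_rescale {t c : ℝ} (ht : 0 ≤ t) (hc : 1 ≤ c) : 1 / (1 + t * c⁻¹) ≤ c * (1 / (1 + t)) := by
  have hc0 : 0 < c := by linarith
  have h1 : c * (1 / (1 + t)) = c / (1 + t) := by ring
  rw [h1, div_le_div_iff₀ (by positivity) (by positivity), one_mul]
  have : c * (1 + t * c⁻¹) = c + t := by field_simp
  nlinarith [this]

/-- **(VII.1) in the phase convention `e^{ip·(x−y)}`**: the same statement with `K_q` replaced by `(2π)^{2q}K_q`.
[cite: MagnenRivasseauSeneor1993, §VII (VII.1) p.375 tl.8–13; Rivasseau1991, §III.3 (III.3.3) p.212] -/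
theorem ineqVII1Printed_kernelFamilyPhys (hη : 0 < η) (hM : 1 < M) (N : ℕ → ℕ) :
    Convergence.IneqVII1Printed (kernelFamilyPhys P η M N) M := by
  intro q
  obtain ⟨Kq, hKq⟩ := ineqVII1Printed_kernelFamily (P := P) hη hM N q
  have hM0 : 0 < M := by linarith
  have h2π : 1 ≤ 2 * Real.pi := by linarith [Real.pi_gt_three]
  have hKq0 : 0 ≤ Kq := by
    have h := hKq 1 0 (0, 0)
    have h1 : (0 : ℝ) ≤ |kernelFamily P η M N 1 0 (0, 0)| := abs_nonneg _
    have h2 : Kq * M ^ 1 * M ^ 0 * (1 / (1 + |(0 : ℝ)| * M ^ 0) * (1 / (1 + ‖(0 : E3)‖ * M ^ 1))) ^ q = Kq * M := by simp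
    rw [h2] at h
    nlinarith
  refine ⟨(2 * Real.pi) ^ (2 * q) * Kq, fun i α z => ?_⟩
  have h := hKq i α ((-(2 * Real.pi)⁻¹) • z)
  unfold kernelFamilyPhys
  unfold kernelFamily at h
  split_ifs with hc
  · rw [if_pos hc] at h
    rw [sliceKernelPhys]
    refine h.trans ?_
    have e1 : |((-(2 * Real.pi)⁻¹) • z).1| = |z.1| * (2 * Real.pi)⁻¹ := by
      rw [Prod.smul_fst, smul_eq_mul, abs_mul, abs_neg, abs_inv, abs_of_pos (by positivity), mul_comm]
    have e2 : ‖((-(2 * Real.pi)⁻¹) • z).2‖ = ‖z.2‖ * (2 * Real.pi)⁻¹ := by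
      rw [Prod.smul_snd, norm_smul, Real.norm_eq_abs, abs_neg, abs_inv, abs_of_pos (by positivity), mul_comm]
    rw [e1, e2]
    have ha : 1 / (1 + |z.1| * (2 * Real.pi)⁻¹ * M ^ α) ≤ (2 * Real.pi) * (1 / (1 + |z.1| * M ^ α)) := by
      rw [show |z.1| * (2 * Real.pi)⁻¹ * M ^ α = |z.1| * M ^ α * (2 * Real.pi)⁻¹ by ring]
      exact decay_rescale (by positivity) h2π
    have hb : 1 / (1 + ‖z.2‖ * (2 * Real.pi)⁻¹ * M ^ i) ≤ (2 * Real.pi) * (1 / (1 + ‖z.2‖ * M ^ i)) := by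
      rw [show ‖z.2‖ * (2 * Real.pi)⁻¹ * M ^ i = ‖z.2‖ * M ^ i * (2 * Real.pi)⁻¹ by ring]
      exact decay_rescale (by positivity) h2π
    have hprod : (1 / (1 + |z.1| * (2 * Real.pi)⁻¹ * M ^ α) * (1 / (1 + ‖z.2‖ * (2 * Real.pi)⁻¹ * M ^ i))) ^ q ≤
        ((2 * Real.pi) ^ 2 * (1 / (1 + |z.1| * M ^ α) * (1 / (1 + ‖z.2‖ * M ^ i)))) ^ q := by
      refine pow_le_pow_left₀ (by positivity) ?_ q
      calc 1 / (1 + |z.1| * (2 * Real.pi)⁻¹ * M ^ α) * (1 / (1 + ‖z.2‖ * (2 * Real.pi)⁻¹ * M ^ i))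
          ≤ (2 * Real.pi) * (1 / (1 + |z.1| * M ^ α)) * ((2 * Real.pi) * (1 / (1 + ‖z.2‖ * M ^ i))) :=
            mul_le_mul ha hb (by positivity) (by positivity)
        _ = (2 * Real.pi) ^ 2 * (1 / (1 + |z.1| * M ^ α) * (1 / (1 + ‖z.2‖ * M ^ i))) := by ring
    calc Kq * M ^ i * M ^ α * (1 / (1 + |z.1| * (2 * Real.pi)⁻¹ * M ^ α) * (1 / (1 + ‖z.2‖ * (2 * Real.pi)⁻¹ * M ^ i))) ^ q
        ≤ Kq * M ^ i * M ^ α * ((2 * Real.pi) ^ 2 * (1 / (1 + |z.1| * M ^ α) * (1 / (1 + ‖z.2‖ * M ^ i)))) ^ q :=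
          mul_le_mul_of_nonneg_left hprod (by positivity)
      _ = (2 * Real.pi) ^ (2 * q) * Kq * M ^ i * M ^ α * (1 / (1 + |z.1| * M ^ α) * (1 / (1 + ‖z.2‖ * M ^ i))) ^ q := by
          rw [mul_pow, ← pow_mul]; ring
  · rw [abs_zero]; positivity

end PhysConvention

/-! ## §9 The sibling bound (II.27) for the sliced AXIAL propagator `C^j_axial = κ^j(p)/(p₀² + λ²p²)`, PROVED on the index set 𝐏 -/

section Axial

/-! ### §9a generic: uniform Fourier decay of a smooth family over a compact parameter set -/

variable {Pm : Type*} [NormedAddCommGroup Pm] [NormedSpace ℝ Pm]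

/-- **Uniform Fourier decay of a smooth compactly supported family** over a compact parameter set (the three steps of
`exists_fourier_famC_le` for any parameter space): `Φ : Pm × ℝ⁴ → ℝ` jointly `C^∞`, `Φ(θ, ·)` supported in `B_R` for all
`θ`, `S` compact ⟹ for every `n` ONE `K` with `|𝓕[Φ(θ,·)](w)| ≤ K(1 + |w|)^{−n}` for all `θ ∈ S`, all `w`.
[cite: MagnenRivasseauSeneor1993, §II.B (II.27) p.335 and p.336 tl.2–3; §VII (VII.1) p.375] -/
theorem exists_fourier_family_le {Φ : Pm × E4 → ℝ} (hΦ : ContDiff ℝ ∞ Φ) {R : ℝ}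
    (hsupp : ∀ θ, Function.support (fun v => Φ (θ, v)) ⊆ Metric.closedBall (0 : E4) R) {S : Set Pm}
    (hS : IsCompact S) (n : ℕ) :
    ∃ K : ℝ, 0 ≤ K ∧ ∀ θ ∈ S, ∀ w : E4,
      ‖𝓕 (fun v => ((Φ (θ, v) : ℝ) : ℂ)) w‖ ≤ K * ((1 + ‖w‖) ^ n)⁻¹ := by
  choose B hB0 hB using fun m : ℕ =>
    exists_uniform_bound_iteratedFDeriv (F := ℝ) hΦ hS (fun θ _ => hsupp θ) (m := m) le_top
  set Bs : ℝ := ∑ m ∈ Finset.range (n + 1), B m with hBs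
  have hBs0 : 0 ≤ Bs := Finset.sum_nonneg (fun m _ => hB0 m)
  have hBle : ∀ m, m ≤ n → B m ≤ Bs := fun m hm =>
    Finset.single_le_sum (f := B) (fun m _ => hB0 m) (Finset.mem_range.mpr (Nat.lt_succ_of_le hm))
  set VR : ℝ := (volume (Metric.closedBall (0 : E4) R)).toReal
  refine ⟨4 ^ n * (n + 2) * Bs * VR, by positivity, fun θ hθ w => ?_⟩
  have hreal : ContDiff ℝ ∞ (fun v => Φ (θ, v)) := hΦ.comp (contDiff_const.prodMk contDiff_id)
  have hfC : ContDiff ℝ n (fun v => ((Φ (θ, v) : ℝ) : ℂ)) :=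
    Complex.ofRealCLM.contDiff.comp (hreal.of_le (by exact_mod_cast le_top))
  have hsuppC : Function.support (fun v => ((Φ (θ, v) : ℝ) : ℂ)) ⊆ Metric.closedBall (0 : E4) R := by
    intro v hv
    apply hsupp θ
    rw [Function.mem_support] at hv ⊢
    exact fun h => hv (by simp [h])
  have hboundC : ∀ m, m ≤ n → ∀ v, ‖iteratedFDeriv ℝ m (fun v => ((Φ (θ, v) : ℝ) : ℂ)) v‖ ≤ Bs := by
    intro m hm v
    have heq : ‖iteratedFDeriv ℝ m (fun v => ((Φ (θ, v) : ℝ) : ℂ)) v‖ = ‖iteratedFDeriv ℝ m (fun v => Φ (θ, v)) v‖ :=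
      LinearIsometry.norm_iteratedFDeriv_comp_left (Complex.ofRealLI) (hreal.contDiffAt (x := v)) (i := m)
        (by exact_mod_cast le_top)
    rw [heq]
    exact (hB m θ hθ v).trans (hBle m hm)
  exact norm_fourier_le_of_iteratedFDeriv_le hfC hBs0 hsuppC hboundC w

/-! ### §9b the numerator common to all scaled families and its support -/

variable {g ψ : ℝ → ℝ}

/-- The common numerator `g(|v₀|)·ψ(‖(εv₀, v⃗)‖)` forces `|v| ≤ 2R₀` when both profiles vanish beyond `R₀`.
[cite: MagnenRivasseauSeneor1993, §II.B (II.21a)–(II.21b) p.335] -/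
theorem norm_le_of_num_ne_zero {R₀ : ℝ} (hR₀ : 0 ≤ R₀) (hgR : ∀ r, R₀ ≤ r → g r = 0)
    (hψR : ∀ r, R₀ ≤ r → ψ r = 0) {ε : ℝ} {v : E4} (h1 : g |timeC v| ≠ 0) (h2 : ψ ‖scale ε 1 v‖ ≠ 0) :
    ‖v‖ ≤ 2 * R₀ := by
  have ht : |timeC v| < R₀ := lt_of_not_ge (fun h => h1 (hgR _ h))
  have hs' : ‖scale ε 1 v‖ < R₀ := lt_of_not_ge (fun h => h2 (hψR _ h))
  have hs : ‖spat v‖ < R₀ := by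
    have := norm_spat_le_norm (scale ε 1 v)
    rw [spat_scale, one_smul] at this
    exact this.trans_lt hs'
  have hsq := norm_sq_eq v
  nlinarith [abs_nonneg (timeC v), norm_nonneg (spat v), norm_nonneg v, sq_abs (timeC v)]

/-! ### §9c the two scaled axial families -/

/-- The scaled axial slice, PURE time slices (`α > N_i`): parameters `θ = (ε, r, λ)`,
`Ψ(θ, v) = g(|v₀|) ψ(‖(εv₀, v⃗)‖) / ((1 + λ²)v₀² + r²|v⃗|²)` — the time profile `g = ψ` vanishes near `0`, so the family is
jointly smooth for ALL `r` (the denominator only vanishes on `v₀ = 0`). [cite: MagnenRivasseauSeneor1993, §II.B (II.27) p.335] -/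
def famAxP (g ψ : ℝ → ℝ) (q : (ℝ × ℝ × ℝ) × E4) : ℝ :=
  g |timeC q.2| * ψ ‖scale q.1.1 1 q.2‖ * ((1 + q.1.2.2 ^ 2) * timeC q.2 ^ 2 + q.1.2.1 ^ 2 * ‖spat q.2‖ ^ 2)⁻¹

/-- The scaled axial slice, BOTTOM block (`α = N_i`, cumulative time cutoff): parameters `θ = (ε, ρ, λ)` with the spatial
coefficient `r² = 1 + ρ² ≥ 1` (on the bottom block `λM^i ≥ M^{N_i}`): `Ψ(θ, v) = g(|v₀|) ψ(‖(εv₀, v⃗)‖) / ((1 + λ²)v₀² + (1 + ρ²)|v⃗|²)`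
— the denominator only vanishes at `v = 0`, near which the slice profile vanishes. [cite: MagnenRivasseauSeneor1993, §II.B (II.27) p.335] -/
def famAxB (g ψ : ℝ → ℝ) (q : (ℝ × ℝ × ℝ) × E4) : ℝ :=
  g |timeC q.2| * ψ ‖scale q.1.1 1 q.2‖ * ((1 + q.1.2.2 ^ 2) * timeC q.2 ^ 2 + (1 + q.1.2.1 ^ 2) * ‖spat q.2‖ ^ 2)⁻¹

/-- the time-profile factor `g(|v₀|)` is jointly smooth. [folklore] -/
private theorem contDiff_numA (hg : ContDiff ℝ ∞ g) (hg0 : ∃ δ : ℝ, 0 < δ ∧ ∀ r, r < δ → g r = g 0) :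
    ContDiff ℝ ∞ (fun q : (ℝ × ℝ × ℝ) × E4 => g |timeC q.2|) := by
  obtain ⟨δg, hδg, hg0'⟩ := hg0
  have h1 : ContDiff ℝ ∞ (fun s : ℝ => g (1 * ‖s‖)) := Ansatz.contDiff_comp_norm_mul hg hδg hg0' one_pos
  simp only [one_mul, Real.norm_eq_abs] at h1
  exact h1.comp ((contDiff_piLp_apply (𝕜 := ℝ) (p := 2) (i := (0 : Fin 4))).comp contDiff_snd)

/-- `(θ, v) ↦ (ε v₀, v⃗)` is jointly smooth on `(ℝ × ℝ × ℝ) × ℝ⁴`. [folklore] -/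
private theorem contDiff_scale3 : ContDiff ℝ ∞ (fun q : (ℝ × ℝ × ℝ) × E4 => scale q.1.1 1 q.2) := by
  rw [contDiff_euclidean]
  intro i
  simp_rw [scale_apply]
  refine Fin.cases ?_ (fun j => ?_) i
  · simp only [diagW_zero]
    exact (contDiff_fst.comp contDiff_fst).mul
      ((contDiff_piLp_apply (𝕜 := ℝ) (p := 2) (i := (0 : Fin 4))).comp contDiff_snd)
  · simp only [diagW_succ, one_mul]
    exact (contDiff_piLp_apply (𝕜 := ℝ) (p := 2) (i := j.succ)).comp contDiff_snd

/-- the slice-profile factor `ψ(‖(εv₀, v⃗)‖)` is jointly smooth. [folklore] -/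
private theorem contDiff_numB (hψ : ContDiff ℝ ∞ ψ) (hψ0 : ∃ δ : ℝ, 0 < δ ∧ ∀ r, r < δ → ψ r = 0) :
    ContDiff ℝ ∞ (fun q : (ℝ × ℝ × ℝ) × E4 => ψ ‖scale q.1.1 1 q.2‖) := by
  obtain ⟨δ, hδ, hψ0'⟩ := hψ0
  have hψ00 : ∀ r, r < δ → ψ r = ψ 0 := fun r hr => by rw [hψ0' r hr, hψ0' 0 hδ]
  have h1 : ContDiff ℝ ∞ (fun p : E4 => ψ (1 * ‖p‖)) := Ansatz.contDiff_comp_norm_mul hψ hδ hψ00 one_pos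
  simp only [one_mul] at h1
  exact h1.comp contDiff_scale3

/-- `v₀²` is jointly smooth. [folklore] -/
private theorem contDiff_timeC_sq : ContDiff ℝ ∞ (fun q : (ℝ × ℝ × ℝ) × E4 => timeC q.2 ^ 2) :=
  ((contDiff_piLp_apply (𝕜 := ℝ) (p := 2) (i := (0 : Fin 4))).comp contDiff_snd).pow 2

/-- `‖v⃗‖²` is jointly smooth. [folklore] -/
private theorem contDiff_spat_sq : ContDiff ℝ ∞ (fun q : (ℝ × ℝ × ℝ) × E4 => ‖spat q.2‖ ^ 2) := by
  have hsp : ContDiff ℝ ∞ (fun p : E4 => spat p) := by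
    rw [contDiff_piLp]
    intro j
    simpa [spat] using (contDiff_piLp_apply (𝕜 := ℝ) (p := 2) (i := j.succ) (E := fun _ : Fin 4 => ℝ))
  exact (contDiff_norm_sq ℝ).comp (hsp.comp contDiff_snd)

/-- the coefficient `1 + λ²` is jointly smooth. [folklore] -/
private theorem contDiff_lamC : ContDiff ℝ ∞ (fun q : (ℝ × ℝ × ℝ) × E4 => 1 + q.1.2.2 ^ 2) :=
  contDiff_const.add (((contDiff_snd.comp (contDiff_snd.comp contDiff_fst))).pow 2)

/-- the coefficient `r²` is jointly smooth. [folklore] -/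
private theorem contDiff_rC : ContDiff ℝ ∞ (fun q : (ℝ × ℝ × ℝ) × E4 => q.1.2.1 ^ 2) :=
  ((contDiff_fst.comp (contDiff_snd.comp contDiff_fst))).pow 2

/-- Joint smoothness of the pure axial family (`g`, `ψ` both vanish near `0`). [cite: MagnenRivasseauSeneor1993, §II.B (II.27) p.335] -/
theorem contDiff_famAxP (hg : ContDiff ℝ ∞ g) (hg0 : ∃ δ : ℝ, 0 < δ ∧ ∀ r, r < δ → g r = 0)
    (hψ : ContDiff ℝ ∞ ψ) (hψ0 : ∃ δ : ℝ, 0 < δ ∧ ∀ r, r < δ → ψ r = 0) :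
    ContDiff ℝ ∞ (famAxP g ψ) := by
  obtain ⟨δg, hδg, hg0'⟩ := hg0
  have hA := contDiff_numA (g := g) hg ⟨δg, hδg, fun r hr => by rw [hg0' r hr, hg0' 0 hδg]⟩
  have hB := contDiff_numB hψ hψ0
  have hD : ContDiff ℝ ∞ (fun q : (ℝ × ℝ × ℝ) × E4 =>
      (1 + q.1.2.2 ^ 2) * timeC q.2 ^ 2 + q.1.2.1 ^ 2 * ‖spat q.2‖ ^ 2) :=
    (contDiff_lamC.mul contDiff_timeC_sq).add (contDiff_rC.mul contDiff_spat_sq)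
  rw [contDiff_iff_contDiffAt]
  intro q
  by_cases hq : timeC q.2 = 0
  · have hcont : Continuous (fun q' : (ℝ × ℝ × ℝ) × E4 => timeC q'.2) :=
      ((contDiff_piLp_apply (𝕜 := ℝ) (n := ((⊤ : ℕ∞) : ℕ∞ω)) (p := 2) (i := (0 : Fin 4))).comp contDiff_snd).continuous
    have hopen : IsOpen {q' : (ℝ × ℝ × ℝ) × E4 | |timeC q'.2| < δg} :=
      isOpen_lt (continuous_abs.comp hcont) continuous_const
    have hmem : q ∈ {q' : (ℝ × ℝ × ℝ) × E4 | |timeC q'.2| < δg} := by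
      show |timeC q.2| < δg; rw [hq, abs_zero]; exact hδg
    have hev : ∀ᶠ q' in nhds q, famAxP g ψ q' = 0 := by
      filter_upwards [hopen.mem_nhds hmem] with q' hq'
      have h0 : g |timeC q'.2| = 0 := hg0' _ hq'
      simp only [famAxP, h0, zero_mul]
    exact (contDiffAt_const (c := (0 : ℝ))).congr_of_eventuallyEq hev
  · have hne : (1 + q.1.2.2 ^ 2) * timeC q.2 ^ 2 + q.1.2.1 ^ 2 * ‖spat q.2‖ ^ 2 ≠ 0 := by
      have : 0 < timeC q.2 ^ 2 := by positivity
      nlinarith [sq_nonneg q.1.2.2, sq_nonneg q.1.2.1, norm_nonneg (spat q.2), mul_nonneg (sq_nonneg q.1.2.1) (sq_nonneg ‖spat q.2‖)]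
    exact (hA.contDiffAt.mul hB.contDiffAt).mul (hD.contDiffAt.inv hne)

/-- Joint smoothness of the bottom-block axial family (`ψ` vanishes near `0`, spatial coefficient `≥ 1`).
[cite: MagnenRivasseauSeneor1993, §II.B (II.27) p.335] -/
theorem contDiff_famAxB (hg : ContDiff ℝ ∞ g) (hg0 : ∃ δ : ℝ, 0 < δ ∧ ∀ r, r < δ → g r = g 0)
    (hψ : ContDiff ℝ ∞ ψ) (hψ0 : ∃ δ : ℝ, 0 < δ ∧ ∀ r, r < δ → ψ r = 0) :
    ContDiff ℝ ∞ (famAxB g ψ) := by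
  obtain ⟨δ, hδ, hψ0'⟩ := hψ0
  have hA := contDiff_numA hg hg0
  have hB := contDiff_numB hψ ⟨δ, hδ, hψ0'⟩
  have hD : ContDiff ℝ ∞ (fun q : (ℝ × ℝ × ℝ) × E4 =>
      (1 + q.1.2.2 ^ 2) * timeC q.2 ^ 2 + (1 + q.1.2.1 ^ 2) * ‖spat q.2‖ ^ 2) :=
    (contDiff_lamC.mul contDiff_timeC_sq).add ((contDiff_const.add contDiff_rC).mul contDiff_spat_sq)
  rw [contDiff_iff_contDiffAt]
  intro q
  by_cases hq : scale q.1.1 1 q.2 = 0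
  · have hopen : IsOpen {q' : (ℝ × ℝ × ℝ) × E4 | ‖scale q'.1.1 1 q'.2‖ < δ} :=
      isOpen_lt (continuous_norm.comp contDiff_scale3.continuous) continuous_const
    have hmem : q ∈ {q' : (ℝ × ℝ × ℝ) × E4 | ‖scale q'.1.1 1 q'.2‖ < δ} := by
      show ‖scale q.1.1 1 q.2‖ < δ; rw [hq, norm_zero]; exact hδ
    have hev : ∀ᶠ q' in nhds q, famAxB g ψ q' = 0 := by
      filter_upwards [hopen.mem_nhds hmem] with q' hq'
      have h0 : ψ ‖scale q'.1.1 1 q'.2‖ = 0 := hψ0' _ hq'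
      simp only [famAxB, h0, mul_zero, zero_mul]
    exact (contDiffAt_const (c := (0 : ℝ))).congr_of_eventuallyEq hev
  · -- `(ε v₀, v⃗) ≠ 0` forces `v₀ ≠ 0` or `v⃗ ≠ 0`, so the denominator is positive
    have hne : (1 + q.1.2.2 ^ 2) * timeC q.2 ^ 2 + (1 + q.1.2.1 ^ 2) * ‖spat q.2‖ ^ 2 ≠ 0 := by
      intro h0
      have h1 : timeC q.2 ^ 2 = 0 := by
        nlinarith [sq_nonneg (timeC q.2), sq_nonneg q.1.2.2, sq_nonneg q.1.2.1, sq_nonneg ‖spat q.2‖,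
          mul_nonneg (sq_nonneg q.1.2.2) (sq_nonneg (timeC q.2)), mul_nonneg (sq_nonneg q.1.2.1) (sq_nonneg ‖spat q.2‖)]
      have h2 : ‖spat q.2‖ ^ 2 = 0 := by
        nlinarith [sq_nonneg (timeC q.2), sq_nonneg q.1.2.2, sq_nonneg q.1.2.1, sq_nonneg ‖spat q.2‖,
          mul_nonneg (sq_nonneg q.1.2.2) (sq_nonneg (timeC q.2)), mul_nonneg (sq_nonneg q.1.2.1) (sq_nonneg ‖spat q.2‖)]
      apply hq
      have ht : timeC q.2 = 0 := pow_eq_zero_iff (n := 2) (by norm_num) |>.mp h1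
      have hs : spat q.2 = 0 := norm_eq_zero.mp (pow_eq_zero_iff (n := 2) (by norm_num) |>.mp h2)
      ext i
      rw [scale_apply]
      refine Fin.cases ?_ (fun j => ?_) i
      · simpa [timeC] using Or.inr ht
      · have := congrArg (fun w : E3 => w j) hs
        simpa [spat] using this
    exact (hA.contDiffAt.mul hB.contDiffAt).mul (hD.contDiffAt.inv hne)

/-- Support of both axial families, uniformly in the parameters. [cite: MagnenRivasseauSeneor1993, §II.B (II.27) p.335] -/
theorem support_famAx_subset {R₀ : ℝ} (hR₀ : 0 ≤ R₀) (hgR : ∀ r, R₀ ≤ r → g r = 0) (hψR : ∀ r, R₀ ≤ r → ψ r = 0)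
    (θ : ℝ × ℝ × ℝ) :
    Function.support (fun v => famAxP g ψ (θ, v)) ⊆ Metric.closedBall (0 : E4) (2 * R₀) ∧
      Function.support (fun v => famAxB g ψ (θ, v)) ⊆ Metric.closedBall (0 : E4) (2 * R₀) := by
  constructor <;> intro v hv <;> rw [Function.mem_support] at hv <;> rw [Metric.mem_closedBall, dist_zero_right]
  · have h1 : g |timeC v| ≠ 0 := fun h => hv (by simp [famAxP, h])
    have h2 : ψ ‖scale θ.1 1 v‖ ≠ 0 := fun h => hv (by simp [famAxP, h])
    exact norm_le_of_num_ne_zero hR₀ hgR hψR h1 h2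
  · have h1 : g |timeC v| ≠ 0 := fun h => hv (by simp [famAxB, h])
    have h2 : ψ ‖scale θ.1 1 v‖ ≠ 0 := fun h => hv (by simp [famAxB, h])
    exact norm_le_of_num_ne_zero hR₀ hgR hψR h1 h2

end Axial

/-! ### §9d the generic Fourier assembly: a kernel that is a scaled family inherits the family's decay -/

section Assembly

/-- If `h(a v₀, b v⃗) = c · F(v)` (an exact anisotropic dilate) and `|𝓕F(w)| ≤ K(1 + |w|)^{−n}`, then
`|Re 𝓕h(z)| ≤ |c|·a b³·K·(1 + |(a z₀, b z⃗)|)^{−n}` (`𝓕(F∘A⁻¹) = det A · 𝓕F∘A`, `det = ab³`).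
[cite: MagnenRivasseauSeneor1993, §II.B (II.27) p.335; §VII (VII.1) p.375] -/
theorem abs_re_fourier_le_of_scale {h F : E4 → ℝ} {a b c K : ℝ} (ha : 0 < a) (hb : 0 < b) {n : ℕ}
    (hscale : ∀ v, h (scale a b v) = c * F v)
    (hF : ∀ w, ‖𝓕 (fun v => ((F v : ℝ) : ℂ)) w‖ ≤ K * ((1 + ‖w‖) ^ n)⁻¹) (z : ℝ × E3) :
    |(𝓕 (fun p => ((h p : ℝ) : ℂ)) (emb z)).re| ≤
      |c| * (a * b ^ 3) * K * ((1 + ‖scale a b (emb z)‖) ^ n)⁻¹ := by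
  set A := scaleEquiv a b ha.ne' hb.ne' with hA
  have hmom : (fun p : E4 => ((h p : ℝ) : ℂ)) = fun p => ((c : ℝ) : ℂ) * ((F (A.symm p) : ℝ) : ℂ) := by
    funext p
    have hp : scale a b (A.symm p) = p := by
      rw [hA]; exact (scaleEquiv a b ha.ne' hb.ne').apply_symm_apply p
    rw [← Complex.ofReal_mul, ← hscale, hp]
  have hAsym : ∀ u v : E4, ⟪A u, v⟫_ℝ = ⟪u, A v⟫_ℝ := fun u v => by
    rw [hA, scaleEquiv_apply, scaleEquiv_apply, inner_scale_comm]
  have hdet : LinearMap.det (A.toLinearEquiv : E4 →ₗ[ℝ] E4) = a * b ^ 3 := by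
    rw [show (A.toLinearEquiv : E4 →ₗ[ℝ] E4) = (scale a b : E4 →ₗ[ℝ] E4) from rfl, det_scale]
  have h1 : 𝓕 (fun p : E4 => ((c : ℝ) : ℂ) * ((F (A.symm p) : ℝ) : ℂ)) (emb z) =
      ((c : ℝ) : ℂ) * 𝓕 (fun p => ((F (A.symm p) : ℝ) : ℂ)) (emb z) :=
    fourier_const_mul _ (fun p => ((F (A.symm p) : ℝ) : ℂ)) _
  have h2 : 𝓕 (fun p => ((F (A.symm p) : ℝ) : ℂ)) (emb z) =
      (((|LinearMap.det (A.toLinearEquiv : E4 →ₗ[ℝ] E4)| : ℝ)) : ℂ) * 𝓕 (fun v => ((F v : ℝ) : ℂ)) (A (emb z)) :=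
    fourier_comp_symm A hAsym (fun v => ((F v : ℝ) : ℂ)) (emb z)
  have hAz : A (emb z) = scale a b (emb z) := rfl
  rw [hmom, h1, h2, hdet, hAz, ← mul_assoc, ← Complex.ofReal_mul]
  have hK : 0 ≤ K := by
    have := (norm_nonneg _).trans (hF 0)
    simp at this
    exact this
  calc |((((c * |a * b ^ 3| : ℝ)) : ℂ) * 𝓕 (fun v => ((F v : ℝ) : ℂ)) (scale a b (emb z))).re|
      ≤ ‖(((c * |a * b ^ 3| : ℝ)) : ℂ) * 𝓕 (fun v => ((F v : ℝ) : ℂ)) (scale a b (emb z))‖ := Complex.abs_re_le_norm _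
    _ = |c| * (a * b ^ 3) * ‖𝓕 (fun v => ((F v : ℝ) : ℂ)) (scale a b (emb z))‖ := by
        rw [norm_mul, Complex.norm_real, Real.norm_eq_abs, abs_mul, abs_abs,
          abs_of_pos (show 0 < a * b ^ 3 by positivity)]
    _ ≤ |c| * (a * b ^ 3) * (K * ((1 + ‖scale a b (emb z)‖) ^ n)⁻¹) :=
        mul_le_mul_of_nonneg_left (hF _) (by positivity)
    _ = |c| * (a * b ^ 3) * K * ((1 + ‖scale a b (emb z)‖) ^ n)⁻¹ := by ring

/-- The isotropic decay in `|(a z₀, b z⃗)|` of order `2q` dominates the printed product of the two anisotropic decays of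
order `q`. [cite: MagnenRivasseauSeneor1993, §II.B (II.27) p.335; §VII (VII.1) p.375] -/
theorem decay_prod_of_scale {a b : ℝ} (ha : 0 < a) (hb : 0 < b) (q : ℕ) (z : ℝ × E3) :
    ((1 + ‖scale a b (emb z)‖) ^ (2 * q))⁻¹ ≤ (1 / (1 + |z.1| * a) * (1 / (1 + ‖z.2‖ * b))) ^ q := by
  have ht : a * |z.1| ≤ ‖scale a b (emb z)‖ := by
    have h := abs_timeC_le_norm (scale a b (emb z))
    rwa [(norm_scale_emb a b z).1, abs_of_pos ha] at h
  have hs : b * ‖z.2‖ ≤ ‖scale a b (emb z)‖ := by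
    have h := norm_spat_le_norm (scale a b (emb z))
    rwa [(norm_scale_emb a b z).2, abs_of_pos hb] at h
  rw [mul_pow, one_div, one_div, inv_pow, inv_pow, ← mul_inv]
  have h1 : 0 < (1 + |z.1| * a) ^ q * (1 + ‖z.2‖ * b) ^ q := by positivity
  refine inv_anti₀ h1 ?_
  rw [two_mul, pow_add]
  exact mul_le_mul (pow_le_pow_left₀ (by positivity) (by linarith [mul_comm a |z.1|]) q)
    (pow_le_pow_left₀ (by positivity) (by linarith [mul_comm b ‖z.2‖]) q) (by positivity) (by positivity)

end Assembly

/-! ### §9e MRS's sliced axial propagator and (II.27) -/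

section AxialKernel

variable (P : Ansatz.CutoffProfile) (η M : ℝ) (N : ℕ → ℕ) (lam : ℝ)

/-- **The sliced axial-gauge propagator, momentum space**: `C^j_axial(p) = κ^j(p) C_axial(p)` (p.335 tl.34–37) with
`C_axial(p)⁻¹ = p₀² + λ²p²` — the symbol (II.19) `⟨A, p₀²A⟩ + Σ_i (λ_i^t)²⟨A p²κ^i(p) A⟩ = ⟨A, C_axial⁻¹A⟩` read with one
coupling `λ` on the slices ((II.27) prints a single `λ`) and the fake cutoff `κ_{ρ₁} ≡ 1` on the slice (MODEL reading, declared;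
the tree's `Ansatz.invCaxial` keeps the sum). [cite: MagnenRivasseauSeneor1993, §II.A (II.16), (II.19) p.332; §II.B (II.27) p.335] -/
def axialSliceMom (i α : ℕ) (p : E4) : ℝ :=
  Ansatz.anisoSlice P η M (N i) i α ‖p‖ |timeC p| / (timeC p ^ 2 + lam ^ 2 * ‖p‖ ^ 2)

/-- **The sliced axial-gauge propagator, position space**: `C^j_axial(x − y) = Re ∫ e^{−2πi p·(x−y)} C^j_axial(p) d⁴p`.
[cite: MagnenRivasseauSeneor1993, §II.B (II.27) p.335] -/
def axialSliceKernel (i α : ℕ) (z : ℝ × E3) : ℝ :=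
  (𝓕 (fun p : E4 => ((axialSliceMom P η M N lam i α p : ℝ) : ℂ)) (emb z)).re

variable {P η M N lam}

/-- The exact anisotropic scaling of the axial slice: with `a = M^α`, `b = M^i` (`i = k + 1`), `ε = a/b`, `r = λ b/a`,
`C^j_axial(a v₀, b v⃗) = a^{−2} · g(|v₀|) ψ(|(εv₀, v⃗)|) / ((1 + λ²)v₀² + r²|v⃗|²)`.
[cite: MagnenRivasseauSeneor1993, §II.B (II.27) p.335, p.336 tl.2–5] -/
theorem axialSliceMom_scale (hM : 0 < M) (k α : ℕ) (v : E4) :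
    axialSliceMom P η M N lam (k + 1) α (scale (M ^ α) (M ^ (k + 1)) v) =
      ((M ^ α) ^ 2)⁻¹ *
        (timeProfile P η M (N (k + 1)) α |timeC v| * unitSlice P η M ‖scale (M ^ α / M ^ (k + 1)) 1 v‖ *
          ((1 + lam ^ 2) * timeC v ^ 2 + (lam * M ^ (k + 1) / M ^ α) ^ 2 * ‖spat v‖ ^ 2)⁻¹) := by
  set a : ℝ := M ^ α with ha
  set b : ℝ := M ^ (k + 1) with hb
  have ha0 : 0 < a := pow_pos hM _
  have hb0 : 0 < b := pow_pos hM _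
  have hsm : scale a b v = b • scale (a / b) 1 v := scale_eq_smul hb0.ne' v
  have hnorm : ‖scale a b v‖ = b * ‖scale (a / b) 1 v‖ := by
    rw [hsm, norm_smul, Real.norm_eq_abs, abs_of_pos hb0]
  have htime : |timeC (scale a b v)| * a⁻¹ = |timeC v| := by
    rw [timeC_scale, abs_mul, abs_of_pos ha0]
    field_simp
  have hden : timeC (scale a b v) ^ 2 + lam ^ 2 * ‖scale a b v‖ ^ 2 =
      a ^ 2 * ((1 + lam ^ 2) * timeC v ^ 2 + (lam * b / a) ^ 2 * ‖spat v‖ ^ 2) := by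
    rw [norm_sq_eq (scale a b v), timeC_scale, spat_scale, norm_smul, Real.norm_eq_abs, abs_of_pos hb0]
    field_simp
    ring
  rw [axialSliceMom, hden, Ansatz.anisoSlice, timeFactor_eq P η M hM, htime, sliceCutoff_succ_eq_unitSlice P η M hM,
    ← hb, hnorm]
  have h1 : b * ‖scale (a / b) 1 v‖ * b⁻¹ = ‖scale (a / b) 1 v‖ := by field_simp
  rw [h1, div_eq_mul_inv, mul_inv]
  ring

/-- **(II.27) for the sliced axial propagator, with explicit structure.**  For `η > 0`, `M > 1` and every `q` there is ONE
`K_q ≥ 0` such that for every coupling `0 < λ ≤ 1`, every bottom-index assignment `N`, every slice `i ≥ 1` and every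
`α` with `N_i ≤ α ≤ i + 1` satisfying the two inequalities that DEFINE MRS's index set 𝐏 — `λM^i ≤ M^{α+1}` (i.e.
`α ≥ N_i` with `N_i = ⌊i − |ln λ/ln M|⌋`: «when |p| is of order M^i we want to decompose p₀ between λ_iM^i and M^{i+1}»,
p.334) and, on the bottom block `α = N_i`, `M^α ≤ λM^i` —, and every `z`:
`|C^j_axial(z)| ≤ K_q (M^{2i}/λ) (1 + |z₀|M^α)^{−q} (1 + |z⃗|M^i)^{−q}`. The printed prefactor arises exactly as in the sentence
after (II.27): the Jacobian `M^{3i}M^α` of the slice times the size `M^{−2α}` of `C_axial` there, `M^{3i−α} = (M^{2i}/λ)·(λM^{i−α}) ≤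
M·M^{2i}/λ`. [cite: MagnenRivasseauSeneor1993, §II.B (II.27) p.335 tl.34–38, p.336 tl.2–5; p.334 tl.44–47] -/
theorem exists_axialSliceKernel_bound (hη : 0 < η) (hM : 1 < M) (q : ℕ) :
    ∃ Kq : ℝ, 0 ≤ Kq ∧ ∀ (lam : ℝ), 0 < lam → lam ≤ 1 → ∀ (N : ℕ → ℕ) (k α : ℕ),
      N (k + 1) ≤ α → α ≤ k + 2 → lam * M ^ (k + 1) ≤ M ^ (α + 1) →
      (α = N (k + 1) → M ^ α ≤ lam * M ^ (k + 1)) → ∀ z : ℝ × E3,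
      |axialSliceKernel P η M N lam (k + 1) α z| ≤
        Kq * M ^ (2 * (k + 1)) / lam * (1 / (1 + |z.1| * M ^ α) * (1 / (1 + ‖z.2‖ * M ^ (k + 1)))) ^ q := by
  have hM0 : 0 < M := by linarith
  have hM1 : 1 ≤ M := hM.le
  set R₀ : ℝ := 3 + η⁻¹ with hR₀
  have hR₀0 : 0 ≤ R₀ := by have := inv_pos.mpr hη; positivity
  have hS : IsCompact (Set.Icc (0 : ℝ) M ×ˢ (Set.Icc (0 : ℝ) M ×ˢ Set.Icc (0 : ℝ) 1)) :=
    isCompact_Icc.prod (isCompact_Icc.prod isCompact_Icc)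
  have hψ : ContDiff ℝ ∞ (unitSlice P η M) := contDiff_unitSlice P η M hη _
  have hψ0 : ∃ δ : ℝ, 0 < δ ∧ ∀ r, r < δ → unitSlice P η M r = 0 :=
    ⟨M⁻¹, inv_pos.mpr hM0, fun r hr => unitSlice_eq_zero_of_le P η M hM1 hr.le⟩
  have hψR : ∀ r, R₀ ≤ r → unitSlice P η M r = 0 := fun r hr => unitSlice_eq_zero_of_ge P η M hη hM1 hr
  have hκ : ContDiff ℝ ∞ (Ansatz.cutoffFn P η) := Ansatz.contDiff_cutoffFn P hη _
  have hκ0 : ∃ δ : ℝ, 0 < δ ∧ ∀ r, r < δ → Ansatz.cutoffFn P η r = Ansatz.cutoffFn P η 0 :=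
    ⟨1, one_pos, fun r hr => by rw [Ansatz.cutoffFn_of_le_one P η hr.le, Ansatz.cutoffFn_of_le_one P η zero_le_one]⟩
  have hκR : ∀ r, R₀ ≤ r → Ansatz.cutoffFn P η r = 0 := fun r hr => Ansatz.cutoffFn_eq_zero_of_le P η hη hr
  -- the two uniform Fourier constants
  obtain ⟨KP, hKP0, hKP⟩ := exists_fourier_family_le (contDiff_famAxP hψ hψ0 hψ hψ0)
    (fun θ => (support_famAx_subset (g := unitSlice P η M) hR₀0 hψR hψR θ).1) hS (2 * q)
  obtain ⟨KB, hKB0, hKB⟩ := exists_fourier_family_le (contDiff_famAxB hκ hκ0 hψ hψ0)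
    (fun θ => (support_famAx_subset (g := Ansatz.cutoffFn P η) hR₀0 hκR hψR θ).2) hS (2 * q)
  refine ⟨M * max KP KB, by positivity, fun lam hlam0 hlam1 N k α hNα hα hr1 hr2 z => ?_⟩
  set a : ℝ := M ^ α with ha
  set b : ℝ := M ^ (k + 1) with hb
  have ha0 : 0 < a := pow_pos hM0 _
  have hb0 : 0 < b := pow_pos hM0 _
  set ε : ℝ := a / b with hε
  set r : ℝ := lam * b / a with hr
  have hεI : ε ∈ Set.Icc (0 : ℝ) M := by
    refine ⟨div_nonneg ha0.le hb0.le, ?_⟩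
    rw [hε, div_le_iff₀ hb0, ha, hb, ← pow_succ']
    exact pow_le_pow_right₀ hM1 (by omega)
  have hr0 : 0 ≤ r := by positivity
  have hrM : r ≤ M := by
    rw [hr, div_le_iff₀ ha0]
    calc lam * b ≤ M ^ (α + 1) := hr1
      _ = M * a := by rw [ha, pow_succ']
  have hlamI : lam ∈ Set.Icc (0 : ℝ) 1 := ⟨hlam0.le, hlam1⟩
  have hcoef : |((a ^ 2)⁻¹ : ℝ)| * (a * b ^ 3) = b ^ 2 / lam * r := by
    rw [abs_of_pos (by positivity), hr]
    field_simp
  have hfin : ∀ K : ℝ, 0 ≤ K → K ≤ max KP KB →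
      |((a ^ 2)⁻¹ : ℝ)| * (a * b ^ 3) * K * ((1 + ‖scale a b (emb z)‖) ^ (2 * q))⁻¹ ≤
        M * max KP KB * M ^ (2 * (k + 1)) / lam *
          (1 / (1 + |z.1| * M ^ α) * (1 / (1 + ‖z.2‖ * M ^ (k + 1)))) ^ q := by
    intro K hK0 hKle
    rw [hcoef, ← ha, ← hb, show M ^ (2 * (k + 1)) = b ^ 2 by rw [hb, ← pow_mul, mul_comm]]
    have hdec := decay_prod_of_scale ha0 hb0 q z
    have hD0 : 0 ≤ ((1 + ‖scale a b (emb z)‖) ^ (2 * q))⁻¹ := by positivity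
    calc b ^ 2 / lam * r * K * ((1 + ‖scale a b (emb z)‖) ^ (2 * q))⁻¹
        ≤ b ^ 2 / lam * M * (max KP KB) * (1 / (1 + |z.1| * a) * (1 / (1 + ‖z.2‖ * b))) ^ q := by
          gcongr
      _ = M * max KP KB * b ^ 2 / lam * (1 / (1 + |z.1| * a) * (1 / (1 + ‖z.2‖ * b))) ^ q := by ring
  rw [axialSliceKernel]
  by_cases hbot : α = N (k + 1)
  · -- bottom block: time profile κ, spatial coefficient r² = 1 + ρ² with r ≥ 1
    have hr1' : 1 ≤ r := by
      rw [hr, le_div_iff₀ ha0, one_mul]; exact hr2 hbot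
    set ρ : ℝ := Real.sqrt (r ^ 2 - 1) with hρ
    have hρsq : 1 + ρ ^ 2 = r ^ 2 := by
      rw [hρ, Real.sq_sqrt (by nlinarith)]; ring
    have hρI : ρ ∈ Set.Icc (0 : ℝ) M := by
      refine ⟨Real.sqrt_nonneg _, ?_⟩
      calc ρ ≤ Real.sqrt (r ^ 2) := Real.sqrt_le_sqrt (by linarith)
        _ = r := Real.sqrt_sq hr0
        _ ≤ M := hrM
    have hθ : ((ε, ρ, lam) : ℝ × ℝ × ℝ) ∈ Set.Icc (0 : ℝ) M ×ˢ (Set.Icc (0 : ℝ) M ×ˢ Set.Icc (0 : ℝ) 1) :=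
      ⟨hεI, hρI, hlamI⟩
    have hscale : ∀ v, axialSliceMom P η M N lam (k + 1) α (scale a b v) =
        (a ^ 2)⁻¹ * famAxB (Ansatz.cutoffFn P η) (unitSlice P η M) ((ε, ρ, lam), v) := by
      intro v
      rw [ha, hb, axialSliceMom_scale hM0, famAxB]
      simp only
      rw [hρsq, ← hε, ← hb, ← ha, show lam * b / a = r from rfl, timeProfile, if_pos (Or.inl hbot)]
    exact (abs_re_fourier_le_of_scale ha0 hb0 hscale (hKB _ hθ) z).trans (hfin KB hKB0 (le_max_right _ _))
  · -- pure time slice α > N_i (so α ≥ 1): time profile ψ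
    have hα1 : ¬(α = N (k + 1) ∨ α = 0) := by rintro (h | h) <;> omega
    have hθ : ((ε, r, lam) : ℝ × ℝ × ℝ) ∈ Set.Icc (0 : ℝ) M ×ˢ (Set.Icc (0 : ℝ) M ×ˢ Set.Icc (0 : ℝ) 1) :=
      ⟨hεI, ⟨hr0, hrM⟩, hlamI⟩
    have hscale : ∀ v, axialSliceMom P η M N lam (k + 1) α (scale a b v) =
        (a ^ 2)⁻¹ * famAxP (unitSlice P η M) (unitSlice P η M) ((ε, r, lam), v) := by
      intro v
      rw [ha, hb, axialSliceMom_scale hM0, famAxP]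
      simp only
      rw [← hε, ← hb, ← ha, show lam * b / a = r from rfl, timeProfile, if_neg hα1]
    exact (abs_re_fourier_le_of_scale ha0 hb0 hscale (hKP _ hθ) z).trans (hfin KP hKP0 (le_max_left _ _))

/-- The (II.27) kernel family over all pairs `(i, α)`, as the predicate `LargeField.AxialSliceBound` demands: `C^j_axial` on the
pairs of 𝐏 for the coupling `λ` — `i ≥ 1`, `N_i ≤ α ≤ i + 1`, `λM^i ≤ M^{α+1}`, and `M^α ≤ λM^i` on the bottom block `α = N_i`
(for `N_i = ⌊i − |ln λ/ln M|⌋ ≥ 0` the last two hold automatically) —, `0` elsewhere.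
[cite: MagnenRivasseauSeneor1993, §II.B p.334 tl.44–47, (II.27) p.335] -/
def axialKernelFamily (P : Ansatz.CutoffProfile) (η M : ℝ) (N : ℕ → ℕ) (lam : ℝ) (i α : ℕ) (z : ℝ × E3) : ℝ :=
  if 1 ≤ i ∧ N i ≤ α ∧ α ≤ i + 1 ∧ lam * M ^ i ≤ M ^ (α + 1) ∧ (α = N i → M ^ α ≤ lam * M ^ i)
  then axialSliceKernel P η M N lam i α z else 0

/-- **(II.27) PROVED** in the quantifier shape of the tree's predicate `LargeField.IneqII27Printed` (file `MRS93LargeFieldSmallFactor`,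
typed AS PRINTED by this seat: «A typed predicate on the kernel family — NOT proved here (it is an integration-by-parts estimate …)»):
*«C^j_axial(x − y) ≤ (K_q M^{2i}/λ)(1/(1 + |x₀ − y₀|M^α) · 1/(1 + |x⃗ − y⃗|M^i))^q, (II.27) where K_q is some constant depending
on q»*, for the sliced axial propagator `κ^j(p)/(p₀² + λ²p²)` of MRS's cutoff (II.14) and slices (II.21a/b) on the index set 𝐏,
every `0 < λ ≤ 1` (one `K_q` for all `λ`), `η > 0`, `M > 1`. [cite: MagnenRivasseauSeneor1993, §II.B (II.27) pp.335–336] -/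
theorem ineqII27Printed_axialKernelFamily (hη : 0 < η) (hM : 1 < M) (N : ℕ → ℕ) {lam : ℝ} (hlam0 : 0 < lam)
    (hlam1 : lam ≤ 1) : LargeField.IneqII27Printed (axialKernelFamily P η M N lam) M lam := by
  intro q
  obtain ⟨Kq, hKq0, hKq⟩ := exists_axialSliceKernel_bound (P := P) hη hM q
  refine ⟨Kq, fun i α z => ?_⟩
  unfold axialKernelFamily
  split_ifs with h
  · obtain ⟨hi, hNα, hα, h1, h2⟩ := h
    obtain ⟨k, rfl⟩ : ∃ k, i = k + 1 := ⟨i - 1, by omega⟩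
    have := hKq lam hlam0 hlam1 N k α hNα (by omega) h1 h2 z
    simpa [mul_comm] using this
  · rw [abs_zero]
    have hM0 : 0 < M := by linarith
    positivity

end AxialKernel

/-! ### §9f The «obscure rule» `N_i = ⌊i − |ln λ_i^t/ln M|⌋` is exactly what (II.27) needs -/

section LowIndex

variable {M : ℝ}

/-- **Why `N_i = ⌊i − |ln λ/ln M|⌋`** (p.334 tl.45–47: *«this rule seems obscure but is introduced because when |p| is of order M^i
we want to decompose p₀ between λ_i M^i and M^{i+1}»*): for `0 < λ ≤ 1 < M` and `N_i ≥ 0` equal to MRS's integer part,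
`M^{N_i} ≤ λM^i` (the bottom block reaches down to `λM^i`) and `λM^i ≤ M^{α+1}` for every `α ≥ N_i` — the two inequalities under
which §9e proves (II.27). [cite: MagnenRivasseauSeneor1993, §II.B p.334 tl.44–47; (II.27) p.335] -/
theorem lowIndex_window (hM : 1 < M) {lam : ℝ} (hlam0 : 0 < lam) (hlam1 : lam ≤ 1) (i n : ℕ)
    (hn : (n : ℤ) = Ansatz.lowIndex M lam i) :
    M ^ n ≤ lam * M ^ i ∧ ∀ α : ℕ, n ≤ α → lam * M ^ i ≤ M ^ (α + 1) := by
  have hM0 : 0 < M := by linarith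
  have hlogM : 0 < Real.log M := Real.log_pos hM
  have hloglam : Real.log lam ≤ 0 := Real.log_nonpos hlam0.le hlam1
  set L : ℝ := |Real.log lam / Real.log M| with hL
  have hLval : L = -(Real.log lam / Real.log M) := by
    rw [hL, abs_of_nonpos (div_nonpos_iff.mpr (Or.inr ⟨hloglam, hlogM.le⟩))]
  have hkey : lam * M ^ i = M ^ ((i : ℝ) - L) := by
    rw [sub_eq_add_neg, Real.rpow_add hM0, Real.rpow_natCast, hLval, neg_neg, Real.rpow_def_of_pos hM0,
      show Real.log M * (Real.log lam / Real.log M) = Real.log lam by field_simp, Real.exp_log hlam0, mul_comm]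
  have hfl : ⌊(i : ℝ) - L⌋ = (n : ℤ) := by rw [hn, Ansatz.lowIndex]
  have h1 : (n : ℝ) ≤ (i : ℝ) - L := by
    have := Int.floor_le ((i : ℝ) - L); rw [hfl] at this; exact_mod_cast this
  have h2 : (i : ℝ) - L < n + 1 := by
    have := Int.lt_floor_add_one ((i : ℝ) - L); rw [hfl] at this; exact_mod_cast this
  constructor
  · rw [hkey, ← Real.rpow_natCast]
    exact Real.rpow_le_rpow_of_exponent_le hM.le h1
  · intro α hα
    rw [hkey]
    calc M ^ ((i : ℝ) - L) ≤ M ^ ((n : ℝ) + 1) := Real.rpow_le_rpow_of_exponent_le hM.le h2.le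
      _ = M ^ (n + 1) := by rw [← Real.rpow_natCast]; push_cast; ring_nf
      _ ≤ M ^ (α + 1) := pow_le_pow_right₀ hM.le (by omega)

/-- Hence with MRS's own bottom indices (`(N_i : ℤ) = ⌊i − |ln λ/ln M|⌋`, all `≥ 0`) the (II.27) family is `C^j_axial` on EXACTLY
the index set 𝐏 (`i ≥ 1`, `N_i ≤ α ≤ i + 1`) and `0` off it, and (II.27) holds for it.
[cite: MagnenRivasseauSeneor1993, §II.B p.334 tl.44–47, (II.27) pp.335–336] -/
theorem ineqII27Printed_of_lowIndex {P : Ansatz.CutoffProfile} {η : ℝ} (hη : 0 < η) (hM : 1 < M) {lam : ℝ}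
    (hlam0 : 0 < lam) (hlam1 : lam ≤ 1) (N : ℕ → ℕ) (hN : ∀ i, (N i : ℤ) = Ansatz.lowIndex M lam i) :
    LargeField.IneqII27Printed
      (fun i α z => if 1 ≤ i ∧ N i ≤ α ∧ α ≤ i + 1 then axialSliceKernel P η M N lam i α z else 0) M lam := by
  intro q
  obtain ⟨Kq, hKq⟩ := ineqII27Printed_axialKernelFamily (P := P) hη hM N hlam0 hlam1 q
  refine ⟨Kq, fun i α z => ?_⟩
  have h := hKq i α z
  unfold axialKernelFamily at h
  beta_reduce
  by_cases hc : 1 ≤ i ∧ N i ≤ α ∧ α ≤ i + 1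
  · obtain ⟨hw1, hw2⟩ := lowIndex_window hM hlam0 hlam1 i (N i) (hN i)
    rw [if_pos hc]
    rwa [if_pos ⟨hc.1, hc.2.1, hc.2.2, hw2 α hc.2.1, fun hα => by rw [hα]; exact hw1⟩] at h
  · rw [if_neg hc]
    rw [if_neg (fun h' => hc ⟨h'.1, h'.2.1, h'.2.2.1⟩)] at h
    exact h

end LowIndex

/-! ### §9g (EDITION v1.1) The model symbol IS the tree's (II.19) symbol below the fake cutoff; the diagonal value «M^{2i}/λ» -/

section SymbolLink

variable (P : Ansatz.CutoffProfile) (η M : ℝ)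

/-- With one tentative coupling `λ_i^t = λ` on all slices, the tree's (II.19) symbol `Ansatz.invCaxial` (sum over the slices up
to the fake cutoff `ρ₁`, (II.16)/(II.18)) reduces below the fake cutoff `|p| ≤ M^{ρ₁}` to `p₀² + λ²p²` — the symbol used in
`axialSliceMom` (the slices telescope to `κ_{ρ₁}(|p|) = 1` there). [cite: MagnenRivasseauSeneor1993, (II.16), (II.19) p.332; (II.13)–(II.15) p.331] -/
theorem invCaxial_const_eq (hM : 0 < M) (lam : ℝ) (ρ₁ : ℕ) (p0 : ℝ) {r : ℝ} (hr0 : 0 ≤ r) (hr : r ≤ M ^ ρ₁) :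
    Ansatz.invCaxial P η M (fun _ => lam) ρ₁ p0 (r ^ 2) = p0 ^ 2 + lam ^ 2 * r ^ 2 := by
  rw [Ansatz.invCaxial, Ansatz.invC0, Real.sqrt_sq hr0, ← Finset.mul_sum, Ansatz.sum_sliceCutoff,
    Ansatz.scaledCutoff_eq_one P η hM ρ₁ hr]
  ring

variable {P η M}

/-- Hence, for `M ≥ 3 + η⁻¹` and slices strictly below the fake cutoff (`i + 1 ≤ ρ₁`), the momentum-space axial slice of §9e IS
`κ^j(p)·C_axial(p)` with `C_axial⁻¹` the tree's typed (II.19) symbol at constant tentative couplings — for EVERY momentum `p` (on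
the support of `κ^i`, `|p| < (3 + η⁻¹)M^i ≤ M^{i+1} ≤ M^{ρ₁}`; off it both sides vanish). Of the MODEL reading only «one coupling on
all slices» and «continuum momenta» remain. [cite: MagnenRivasseauSeneor1993, §II.B (II.27) p.335 tl.34–37; (II.19) p.332] -/
theorem axialSliceMom_eq_div_invCaxial (hη : 0 < η) (hM : 3 + η⁻¹ ≤ M) (N : ℕ → ℕ) (lam : ℝ) {ρ₁ k : ℕ}
    (hk : k + 2 ≤ ρ₁) (α : ℕ) (p : E4) :
    axialSliceMom P η M N lam (k + 1) α p =
      Ansatz.anisoSlice P η M (N (k + 1)) (k + 1) α ‖p‖ |timeC p| /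
        Ansatz.invCaxial P η M (fun _ => lam) ρ₁ (timeC p) (‖p‖ ^ 2) := by
  have hη' : 0 < η⁻¹ := inv_pos.mpr hη
  have hM1 : 1 ≤ M := by linarith
  have hM0 : 0 < M := by linarith
  rw [axialSliceMom]
  by_cases hp : ‖p‖ ≤ M ^ ρ₁
  · rw [invCaxial_const_eq P η M hM0 lam ρ₁ (timeC p) (norm_nonneg p) hp]
  · have hge : (3 + η⁻¹) * M ^ (k + 1) ≤ ‖p‖ := by
      calc (3 + η⁻¹) * M ^ (k + 1) ≤ M * M ^ (k + 1) := mul_le_mul_of_nonneg_right hM (by positivity)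
        _ = M ^ (k + 2) := by ring
        _ ≤ M ^ ρ₁ := pow_le_pow_right₀ hM1 hk
        _ ≤ ‖p‖ := (lt_of_not_ge hp).le
    rw [Ansatz.anisoSlice, Ansatz.sliceCutoff_succ_eq_zero_of_ge P η M hη hM1 k hge, zero_mul, zero_div, zero_div]

/-- The diagonal value: *«the factor 1/λ in (II.27) means, as announced, that the Gaussian measure corresponding to C_axial gives
for a field A^j a typical size M^iλ^{−1/2}»* (p.336 tl.8–10) — at coinciding points (II.27) reads `|C^j_axial(0)| ≤ K_q M^{2i}/λ`
`= (M^iλ^{−1/2})²` (on the pairs of 𝐏, same `K_q`). [cite: MagnenRivasseauSeneor1993, §II.B p.336 tl.8–10; (II.27) p.335] -/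
theorem axialSliceKernel_zero_le (hη : 0 < η) (hM : 1 < M) :
    ∃ K : ℝ, 0 ≤ K ∧ ∀ (lam : ℝ), 0 < lam → lam ≤ 1 → ∀ (N : ℕ → ℕ) (k α : ℕ),
      N (k + 1) ≤ α → α ≤ k + 2 → lam * M ^ (k + 1) ≤ M ^ (α + 1) →
      (α = N (k + 1) → M ^ α ≤ lam * M ^ (k + 1)) →
      |axialSliceKernel P η M N lam (k + 1) α (0, 0)| ≤ K * (M ^ (k + 1) * lam ^ (-(1 / 2 : ℝ))) ^ 2 := by
  obtain ⟨K, hK0, hK⟩ := exists_axialSliceKernel_bound (P := P) hη hM 0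
  refine ⟨K, hK0, fun lam hlam0 hlam1 N k α h1 h2 h3 h4 => ?_⟩
  have h := hK lam hlam0 hlam1 N k α h1 h2 h3 h4 (0, 0)
  simp only [pow_zero, mul_one] at h
  refine h.trans (le_of_eq ?_)
  rw [mul_pow, ← Real.rpow_natCast (lam ^ (-(1 / 2 : ℝ))) 2, ← Real.rpow_mul hlam0.le]
  norm_num
  rw [Real.rpow_neg_one, pow_mul, ← div_eq_mul_inv]
  ring

end SymbolLink

/-! ### §9h (EDITION v1.1) «q = 4 makes the propagator summable» -/

section Summable

/-- A decay factor of order `4` is integrable in dimension `< 4`: `(1 + |x|·c)^{−4} ∈ L¹` on a real space of dimension `≤ 3`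
(`c ≠ 0`). [cite: MagnenRivasseauSeneor1993, §II.B p.336 tl.14–16] -/
private theorem integrable_inv_one_add_pow_four {W : Type*} [NormedAddCommGroup W] [NormedSpace ℝ W]
    [MeasurableSpace W] [BorelSpace W] [FiniteDimensional ℝ W] (μ : Measure W) [μ.IsAddHaarMeasure]
    (hW : (Module.finrank ℝ W : ℝ) < 4) {c : ℝ}
    (hc : 0 < c) : Integrable (fun x : W => (1 / (1 + ‖x‖ * c)) ^ 4) μ := by
  have h := (integrable_one_add_norm (E := W) (μ := μ) (r := 4) hW).comp_smul hc.ne'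
  refine h.congr (Filter.Eventually.of_forall (fun x => ?_))
  simp only
  rw [norm_smul, Real.norm_eq_abs, abs_of_pos hc, mul_comm c,
    show (-(4 : ℝ)) = -((4 : ℕ) : ℝ) by norm_num, Real.rpow_neg (by positivity), Real.rpow_natCast, one_div, inv_pow]

/-- *«In theory it might be sufficient to take q in (II.27) equal to 4, so that the propagator is summable, but in practice we will
take it to be large, e.g. 100»* (p.336 tl.14–16): the anisotropic decay factor of (II.27) ∕ (VII.1) with `q = 4` is integrable over
`ℝ × ℝ³` (one time dimension `1 < 4`, three space dimensions `3 < 4`), for all rates `a, b > 0`.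
[cite: MagnenRivasseauSeneor1993, §II.B p.336 tl.14–16; (II.27) p.335] -/
theorem integrable_decay_pow_four {a b : ℝ} (ha : 0 < a) (hb : 0 < b) :
    Integrable (fun z : ℝ × E3 => (1 / (1 + |z.1| * a) * (1 / (1 + ‖z.2‖ * b))) ^ 4) := by
  have h1 : Integrable (fun t : ℝ => (1 / (1 + ‖t‖ * a)) ^ 4) :=
    integrable_inv_one_add_pow_four (W := ℝ) volume (by rw [Module.finrank_self]; norm_num) ha
  have h2 : Integrable (fun y : E3 => (1 / (1 + ‖y‖ * b)) ^ 4) :=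
    integrable_inv_one_add_pow_four (W := E3) volume (by rw [finrank_euclideanSpace, Fintype.card_fin]; norm_num) hb
  have h := h1.mul_prod h2
  refine (h.congr (Filter.Eventually.of_forall (fun z => ?_)))
  simp only [Real.norm_eq_abs, mul_pow]

/-- Hence, with `q = 4`, the sliced axial kernel of (II.27) is dominated by an integrable function on `ℝ × ℝ³` with `L¹` bound
`K_4 (M^{2i}/λ) · ‖(1 + |z₀|M^α)^{−4}(1 + |z⃗|M^i)^{−4}‖_{L¹}` («so that the propagator is summable»), on the pairs of 𝐏.
[cite: MagnenRivasseauSeneor1993, §II.B p.336 tl.14–16; (II.27) p.335] -/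
theorem axialSliceKernel_dominated_integrable {P : Ansatz.CutoffProfile} {η M : ℝ} (hη : 0 < η) (hM : 1 < M) :
    ∃ K : ℝ, 0 ≤ K ∧ ∀ (lam : ℝ), 0 < lam → lam ≤ 1 → ∀ (N : ℕ → ℕ) (k α : ℕ),
      N (k + 1) ≤ α → α ≤ k + 2 → lam * M ^ (k + 1) ≤ M ^ (α + 1) →
      (α = N (k + 1) → M ^ α ≤ lam * M ^ (k + 1)) →
      ∃ g : ℝ × E3 → ℝ, Integrable g ∧
        ∀ z, |axialSliceKernel P η M N lam (k + 1) α z| ≤ K * M ^ (2 * (k + 1)) / lam * g z := by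
  have hM0 : 0 < M := by linarith
  obtain ⟨K, hK0, hK⟩ := exists_axialSliceKernel_bound (P := P) hη hM 4
  refine ⟨K, hK0, fun lam hlam0 hlam1 N k α h1 h2 h3 h4 => ?_⟩
  exact ⟨fun z => (1 / (1 + |z.1| * M ^ α) * (1 / (1 + ‖z.2‖ * M ^ (k + 1)))) ^ 4,
    integrable_decay_pow_four (pow_pos hM0 _) (pow_pos hM0 _),
    fun z => hK lam hlam0 hlam1 N k α h1 h2 h3 h4 z⟩

end Summable

end SliceDecay

end Literature.MathematicalPhysics.QuantumFieldTheory.MagnenRivasseauSeneor1993
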